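import Literature.AlgebraicGeometry.Motives.HodgeThetaAnnihilatorRealBlocksTimesSymplectic
import Literature.AlgebraicGeometry.Motives.HodgeRealSplittingGluedBlocks
import Mathlib.LinearAlgebra.Trace
import HarnessLib

/-!
# Rational tensors on `V₁ ⊕ V₂` killed by `Θ` are killed by `𝔰𝔭(V₁, ψ₁)_ℂ ⊕ 0` and by `0 ⊕ c₂(𝔞)` when `V₁` is RIGID SYMPLECTIC with a SPLIT pair and the second corners are ANISOTROPIC and few (Hazama 1989 / Moonen–Zarhin 1999 Thm. (3.2)(1): `Hg(X₁ × X₂) = Hg(X₁) × Hg(X₂)` — the Lie step for `E × S`, `E` a non-CM elliptic curve, `S` an abelian surface with quaternionic multiplication)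

Family `hodge`, layer `Literature/AlgebraicGeometry/Motives` (abstract polarizable `ℚ`-Hodge structures;
no geometry). Research context: cell `pub-hodge-ring2` (HONEST FRAMING: research route conditional on
HC_CM; not a corollary; Q11.4-sentence-2 already refuted in dim ≥ 3), Literature lane, programme R16 («`E × S(II(1))`»:
a non-CM elliptic curve times a simple abelian surface whose endomorphism algebra is an indefinite quaternion
DIVISION algebra, the last threefold row of Moonen–Zarhin's Thm. 0.1 (4) the tree lacked). This file is
UNCONDITIONAL and no step towards a summit statement. It is the COMPANION of
`HodgeThetaAnnihilatorRealBlocksTimesSymplectic` (programme R14, «generic × generic»), whose Goursat step excludes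
Moonen–Zarhin's graph `Γ_φ` by SIZE (`dim hg(X₁) < dim 𝔰𝔭(V₂)`). For `E × S` with `S` of Type II(1) size cannot
decide: `hg(E) = 𝔰𝔩_{2,ℚ}` and `hg(S) = 𝔰𝔩₁(D°)` (Moonen–Zarhin (2.2) «`Hg(X) = U_{D^opp}`») are BOTH
three-dimensional. Here the graph is excluded by ANISOTROPY instead: a `ℚ`-Lie graph would transport the split
pair `h e − e h = 2 e`, `e ≠ 0` of `𝔰𝔩_{2,ℚ}` into the commutant of `D` in `End_ℚ(H¹ S)`, where every non-zero
element is INVERTIBLE (`H¹(S; ℚ)` is free of rank one over the division algebra `D`), and `y x − x y = 2 x` with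
`x` invertible is impossible (`x⁻¹ y x = y + 2`: conjugate operators have equal trace — Jacobson's lemma in its
simplest instance). So the mechanism differs from Hazama's printed argument (isogeny / `Hom(X₁, X₂) ≠ 0`), but the
RESULT formalized is the printed one: Moonen–Zarhin, Math. Ann. 315 (1999), Thm. (3.2)(1) (= Hazama, Duke Math.
J. 58 (1989); Gordon's survey Thm. 7.6.2) «Let `X₁` and `X₂` be complex abelian varieties which both satisfy
condition (D). (1) Suppose `X₁` and `X₂` contain no factors of Type 4. Then `X₁ × X₂` again satisfies (D), and
either `Hom(X₁, X₂) ≠ 0` or `Hg(X₁ × X₂) = Hg(X₁) × Hg(X₂)`», read through (3.1) «`hg(X₁ × X₂) ≅ 𝔤₁ ⊕ 𝔤₂ ⊕ Γ_φ`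
… where `Γ_φ ⊆ 𝔤₃ ⊕ 𝔤₃` is the graph of the automorphism `φ`» [corpus: paper:arxiv-math_9901113 p. 6], in the
case `X₁ = E` (`Hg = SL₂ = Sp₂`), `X₂ = S` of Type 2(1) (`Hom(E, S) = 0` as `S` is simple of dimension `2`).

SETTING (as in the companion, with the roles of the factors exchanged): a `ℚ`-space `U` presented as `V₁ ⊕ V₂`
(`ι₁, π₁, ι₂, π₂`); Hodge structures `H_U`, `H₁`, `H₂` of the same odd weight with `ι₁`, `ι₂` mapping Hodge
pieces into Hodge pieces; on `V₁` a polarization `ψ₁`, a Hodge operator `Θ₁` and the hypotheses (RIGID) — every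
bracket-closed rational `ψ₁`-skew `𝔤₁` with `Θ₁ ∈ (𝔤₁)_ℂ` contains, after `⊗ ℂ`, every `ψ₁`-skew operator
(the tree's `Θ`-subalgebra theorem `ThetaSubalgebra.mem_spanC_iff_mapsTo_and_skew` with ONE real block, for a
non-CM elliptic curve), (IDEAL) — a non-zero `𝔰𝔭`-stable space of skew operators contains `Θ₁`
(`SymplecticIdeal.theta_mem_of_ne_bot_hodge`), (SPLIT) — rational `ψ₁`-skew `e ≠ 0`, `h` with `h e − e h = 2 e`
(§1, from any alternating non-degenerate form), and `r` linearly independent `ψ₁`-skew operators of `V₁ ⊗ ℂ`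
(`r = 3 = dim 𝔰𝔩₂`); on `V₂` a polarization `ψ₂`, a Hodge operator `Θ₂` and (ANISO) — every rational operator
commuting with `End_Hdg(V₂)` is `0` or invertible, (FEW) — every rational space of `ψ₂`-skew operators commuting
with `End_Hdg(V₂)` has dimension `≤ r` (§1: both hold when `End_Hdg(V₂)` is the image of a division algebra `D`
with `dim_ℚ D = dim_ℚ V₂`; for `S` a simple abelian surface with `dim_ℚ End⁰(S) = 4`: `dim ≤ 3`).
MAIN RESULTS (§3): a RATIONAL coefficient tensor `q` on `U` killed slice by slice by the matrix of `Θ_U` is killed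
by the matrix of `ι₁ ∘ Y ∘ π₁` for EVERY `ψ₁`-skew `Y` of `V₁ ⊗ ℂ`
(`wordDerAt_incl₁_eq_zero_of_symplectic_times_anisotropic` — the conclusion consumed by the evaluation pipeline
of programme R14, file `HodgeTheory/RealSl2BlocksTimesQuaternionInvariance`), and by `ι₂ ∘ W ∘ π₂` for every `W`
lying in the complex span of EVERY admissible algebra of `V₂` (`wordDerAt_incl₂_eq_zero_…`: for `S` of Type II(1)
the glued `𝔰𝔩(W) ⊗ 1` of `HodgeRealSplittingGluedBlocks`) — «`Hg(E × S) = Hg(E) × Hg(S)`» read on tensors.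

PROOF (§2, `goursat_incl_corner_mem_of_anisotropic`). For the rational annihilator algebra `𝔞 ⊆ End_ℚ(U)` of `q`
(block diagonal, bracket-closed, `Θ_U ∈ 𝔞_ℂ`, corners `c₁X` `ψ₁`-skew and `c₂X` `ψ₂`-skew commuting with
`End_Hdg(V₂)`): by (RIGID) `c₁(𝔞)_ℂ` is all of `𝔰𝔭(V₁ ⊗ ℂ)`, so `e, h ∈ c₁(𝔞)` by descent. THE KERNEL
`K = 𝔞 ∩ ker c₂` IS NON-ZERO: otherwise `c₂|_𝔞` is injective and
`dim 𝔞 = dim c₂(𝔞) ≤ r ≤ dim_ℂ c₁(𝔞)_ℂ ≤ dim c₁(𝔞) ≤ dim 𝔞` (FEW) makes `c₁|_𝔞` injective too (a graph); lifting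
`e, h` to `X_e, X_h ∈ 𝔞`, the element `B = [X_h, X_e] − 2 X_e ∈ 𝔞` has `c₁B = 0`, hence `B = 0`, hence
`c₂B = [y, x] − 2x = 0` with `x = c₂X_e ≠ 0` invertible by (ANISO) — absurd (§1 `false_of_commutator_eq_two_smul`).
Then `c₁(K)` is a non-zero ideal of `c₁(𝔞)`, its complex span is `𝔰𝔭`-stable (ideals complexify), contains `Θ₁`
by (IDEAL), is everything by (RIGID), and descent gives `ι₁ Z π₁ ∈ K ⊆ 𝔞` for every rational `ψ₁`-skew `Z`, whence
`ι₂ c₂X π₂ = X − ι₁ c₁X π₁ ∈ 𝔞`: `𝔞 = ι₁ 𝔰𝔭(V₁) π₁ ⊕ ι₂ c₂(𝔞) π₂` — verbatim the companion's proof after the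
kernel step (Deligne LNM 900 I §3 descent; Moonen–Zarhin (3.1)).

CONTENTS (all proved; no definition, no named fact, D-0026): §1 linear algebra — `false_of_commutator_eq_two_smul`
(trace), `exists_skew_pair_commutator_eq_two_smul` (a split pair in `𝔰𝔭(V, B)`), and the anisotropic inputs
`AntiRep.eq_zero_or_isUnit_of_forall_commute`, `AntiRep.finrank_le_of_forall_commute`,
`AntiRep.finrank_lt_of_forall_commute_of_skew` for an anti-representation `θ : D → (End_ℚ V)ᵐᵒᵖ` of a division
algebra with `dim_ℚ D = dim_ℚ V` (`V ≅ D_D`, `RealSplitting.exists_linearEquiv_of_forall_isUnit_or_eq_zero`);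
§2 the Goursat step; §3 the core `incl_skew_mem_annLie_of_symplectic_times_anisotropic` and the two theorems.

## References

* [MoonenZarhin1999LowDim] B. Moonen, Yu. Zarhin, Math. Ann. 315 (1999), §2 (2.2) Type 2(1), §3 (3.1) and
  Thm. (3.2)(1), Thm. 0.1 (4) (held: `paper:arxiv-math_9901113` p. 1, 5–6). [cite: MoonenZarhin1999LowDim, §3 (3.1) and Thm. (3.2)(1)]
* [Hazama1989] F. Hazama, *Algebraic cycles on nonsimple abelian varieties*, Duke Math. J. 58 (1989) 31–37.
  [cite: Hazama1989, Thm. (= Gordon 7.6.2)]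
* [Gordon1999HodgeAVSurvey] B. B. Gordon, *A survey of the Hodge conjecture for abelian varieties*, Thm. 7.6.2
  [corpus: paper:arxiv-alg-geom_9709030 p. 21]. [cite: Gordon1999HodgeAVSurvey, Thm. 7.6.2]
* [Deligne1982HodgeCycles] P. Deligne, LNM 900 (1982), I §3 (proof of Prop. 3.4). [cite: Deligne1982HodgeCycles, I §3 Prop. 3.4]
* [Murty1988] V. Kumar Murty, Proc. AMS 104 (1988), Thm. 2 (p. 67) («`V` free over `E`»). [cite: Murty1988, Thm. 2 (p. 67)]
* [MumfordAV1970] D. Mumford, *Abelian Varieties* (1970), §19 Cor. 2 of Thm. 1 (p. 174). [cite: MumfordAV1970, §19 Cor. 2 of Thm. 1 (p. 174)]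
* [Jacobson1989BasicAlgebraII] N. Jacobson, *Basic Algebra II*, §3.4 (trace of conjugates; right modules over
  division rings). [cite: Jacobson1989BasicAlgebraII, §3.4 eqs. (27)–(31) (pp. 110–111)]
* [GoodmanWallachGTM255] R. Goodman, N. R. Wallach, GTM 255 (2009), §2.1.2 (`𝔰𝔭`), §2.5.3 (`𝔰𝔩₂` triples).
  [cite: GoodmanWallachGTM255, §2.1.2]
-/

noncomputable section

open scoped TensorProduct
open CategoryTheory Module

namespace Literature.AlgebraicGeometry.Motives

namespace HodgeStructure

open RealPlaces Literature.RepresentationTheory.GeneralLinear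

/-! ### §1 Linear algebra: the trace obstruction, a split pair in `𝔰𝔭`, anisotropy of a rank-one module over a division algebra -/

section LinearAlgebra

/-- **`y x − x y = 2 x` with `x` invertible is impossible on a non-zero finite-dimensional space**:
`x⁻¹ (y x − x y) = x⁻¹ y x − y` has trace `0`, while `x⁻¹ (2x) = 2` has trace `2 dim W ≠ 0` (the simplest
case of Jacobson's lemma «if `[y, x]` commutes with `x` it is nilpotent»; in a division algebra nothing non-zero is
nilpotent). [cite: Jacobson1989BasicAlgebraII, §3.4 eqs. (27)–(31) (pp. 110–111)] [cite: GoodmanWallachGTM255, §2.5.3] -/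
theorem false_of_commutator_eq_two_smul {K W : Type*} [Field K] [CharZero K] [AddCommGroup W] [Module K W]
    [FiniteDimensional K W] [Nontrivial W] {x y : Module.End K W} (hx : IsUnit x)
    (h : y * x - x * y = (2 : K) • x) : False := by
  obtain ⟨u, rfl⟩ := hx
  have h1 : (↑u⁻¹ : Module.End K W) * y * ↑u - y = (2 : K) • (1 : Module.End K W) := by
    have h' := congrArg (fun z : Module.End K W => (↑u⁻¹ : Module.End K W) * z) h
    simpa only [mul_sub, ← mul_assoc, Units.inv_mul, one_mul, mul_smul_comm] using h'
  have h2 := congrArg (LinearMap.trace K W) h1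
  rw [map_sub, LinearMap.trace_mul_comm K ((↑u⁻¹ : Module.End K W) * y) (↑u : Module.End K W), ← mul_assoc,
    Units.mul_inv, one_mul, sub_self, map_smul, LinearMap.trace_one, smul_eq_mul] at h2
  have h3 : (Module.finrank K W : K) = 0 := by
    have := h2.symm
    rwa [mul_eq_zero, or_iff_right (two_ne_zero' K)] at this
  exact (Module.finrank_pos (R := K) (M := W)).ne' (by exact_mod_cast h3)

/-- **A split pair in `𝔰𝔭(W, B)`**: for a non-degenerate alternating form `B` on `W ≠ 0` there are `B`-skew
operators `e ≠ 0` and `h` with `h e − e h = 2 e` — pick `B(v₁, v₂) = 1` and take `e = B(v₁, ·) v₁`,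
`h = −(B(v₁, ·) v₂ + B(v₂, ·) v₁)` (the root vector and coroot of `𝔰𝔭`: `e v₂ = v₁`, `h v₁ = v₁`, `h v₂ = −v₂` on
the plane `⟨v₁, v₂⟩`). [cite: GoodmanWallachGTM255, §2.1.2] -/
theorem exists_skew_pair_commutator_eq_two_smul {K W : Type*} [Field K] [CharZero K] [AddCommGroup W] [Module K W]
    [Nontrivial W] (B : LinearMap.BilinForm K W) (hB : B.Nondegenerate) (halt : ∀ x y, B x y = -B y x) :
    ∃ e h : Module.End K W, e ≠ 0 ∧ (∀ v w, B (e v) w + B v (e w) = 0) ∧ (∀ v w, B (h v) w + B v (h w) = 0) ∧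
      h * e - e * h = (2 : K) • e := by
  obtain ⟨v₁, hv₁⟩ := exists_ne (0 : W)
  have hex : ∃ w, B v₁ w ≠ 0 := by
    by_contra hall
    refine hv₁ (hB.1 v₁ fun w => ?_)
    by_contra hw
    exact hall ⟨w, hw⟩
  obtain ⟨v₂', hv₂'⟩ := hex
  set v₂ : W := (B v₁ v₂')⁻¹ • v₂' with hv₂
  have h12 : B v₁ v₂ = 1 := by rw [hv₂, map_smul, smul_eq_mul, inv_mul_cancel₀ hv₂']
  have h21 : B v₂ v₁ = -1 := by rw [halt, h12]
  have hself : ∀ v : W, B v v = 0 := fun v => by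
    have h := halt v v
    have h2 : (2 : K) * B v v = 0 := by linear_combination h
    exact (mul_eq_zero.1 h2).resolve_left (two_ne_zero' K)
  refine ⟨(B v₁).smulRight v₁, -((B v₁).smulRight v₂ + (B v₂).smulRight v₁), ?_, ?_, ?_, ?_⟩
  · intro h0
    have h := congrArg (fun f : Module.End K W => f v₂) h0
    simp only [LinearMap.smulRight_apply, h12, one_smul, LinearMap.zero_apply] at h
    exact hv₁ h
  · intro v w
    simp only [LinearMap.smulRight_apply, map_smul, LinearMap.smul_apply, smul_eq_mul]
    rw [halt v v₁]
    ring
  · intro v w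
    simp only [LinearMap.neg_apply, LinearMap.add_apply, LinearMap.smulRight_apply, map_neg, map_add, map_smul,
      LinearMap.neg_apply, LinearMap.add_apply, LinearMap.smul_apply, smul_eq_mul]
    rw [halt v v₁, halt v v₂]
    ring
  · apply LinearMap.ext
    intro v
    simp only [LinearMap.sub_apply, Module.End.mul_apply, LinearMap.neg_apply, LinearMap.add_apply,
      LinearMap.smulRight_apply, map_neg, map_add, map_smul, LinearMap.smul_apply, hself, h12, h21,
      smul_add, smul_smul, neg_add, smul_neg]
    module

universe u

variable {V : Type u} [AddCommGroup V] [Module ℚ V] [Module.Finite ℚ V]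
variable {D : Type*} [Ring D] [Algebra ℚ D] [Module.Finite ℚ D] (θ : D →ₐ[ℚ] (Module.End ℚ V)ᵐᵒᵖ)

/-- **Anisotropy of the commutant of a division algebra on its rank-one module.** Let `D` be a `ℚ`-algebra in
which every non-zero element is a unit, acting on `V ≠ 0` through an anti-homomorphism `θ : D → (End_ℚ V)ᵐᵒᵖ`
with `dim_ℚ D = dim_ℚ V` (so `V ≅ D_D`, Murty's «`V` free over `E`», Mumford §19 Cor. 2 for `D = End⁰` of a simple
abelian variety). Then every rational operator `X` commuting with all `θ z` is `0` or invertible: `V = θ(D) v₁`,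
`X` is determined by `X v₁ = θ(z₀) v₁`, and `X = (v ↦ θ(z) v₁ ↦ θ(z₀ z) v₁)` is conjugate to left multiplication by
`z₀` on `D`. [cite: Murty1988, Thm. 2 (p. 67)] [cite: MumfordAV1970, §19 Cor. 2 of Thm. 1 (p. 174)]
[cite: MoonenZarhin1999LowDim, §2 (2.2)] -/
theorem AntiRep.eq_zero_or_isUnit_of_forall_commute [Nontrivial V] (hdiv : ∀ z : D, IsUnit z ∨ z = 0)
    (hdeg : Module.finrank ℚ D = Module.finrank ℚ V) {X : Module.End ℚ V}
    (hX : ∀ z : D, X * MulOpposite.unop (θ z) = MulOpposite.unop (θ z) * X) : X = 0 ∨ IsUnit X := by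
  classical
  obtain ⟨v₀, hv₀⟩ := exists_ne (0 : V)
  obtain ⟨e, he⟩ := RealSplitting.exists_linearEquiv_of_forall_isUnit_or_eq_zero θ hdiv hdeg hv₀
  -- `e (z₀ * w) = X (e w)` for `z₀ := e⁻¹ (X (e 1))`
  set z₀ : D := e.symm (X (e 1)) with hz₀
  have hXe : ∀ w : D, X (e w) = e (z₀ * w) := fun w => by
    have h1 : e w = MulOpposite.unop (θ w) (e 1) := by rw [← he w 1, one_mul]
    rw [h1, ← Module.End.mul_apply, hX w, Module.End.mul_apply, he, hz₀, LinearEquiv.apply_symm_apply]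
  by_cases hz : z₀ = 0
  · left
    apply LinearMap.ext
    intro v
    obtain ⟨w, rfl⟩ := e.surjective v
    rw [hXe, hz, zero_mul, map_zero, LinearMap.zero_apply]
  · right
    obtain ⟨uz, huz⟩ := (hdiv z₀).resolve_right hz
    -- the inverse `v = e w ↦ e (z₀⁻¹ * w)`
    set Y : Module.End ℚ V := e.toLinearMap ∘ₗ (LinearMap.mulLeft ℚ (↑uz⁻¹ : D)) ∘ₗ e.symm.toLinearMap with hY
    have hYapply : ∀ w : D, Y (e w) = e ((↑uz⁻¹ : D) * w) := fun w => by
      simp only [hY, LinearMap.comp_apply, LinearEquiv.coe_coe, LinearEquiv.symm_apply_apply,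
        LinearMap.mulLeft_apply]
    refine ⟨⟨X, Y, ?_, ?_⟩, rfl⟩
    · apply LinearMap.ext
      intro v
      obtain ⟨w, rfl⟩ := e.surjective v
      rw [Module.End.mul_apply, hYapply, hXe, ← mul_assoc, ← huz, Units.mul_inv, one_mul, Module.End.one_apply]
    · apply LinearMap.ext
      intro v
      obtain ⟨w, rfl⟩ := e.surjective v
      rw [Module.End.mul_apply, hXe, hYapply, ← mul_assoc, ← huz, Units.inv_mul, one_mul, Module.End.one_apply]

/-- **The commutant of `θ(D)` has dimension `≤ dim_ℚ V`** (it is `D` acting by left multiplications on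
`V ≅ D_D`; here only the injectivity of `X ↦ X v₁` is used). [cite: Murty1988, Thm. 2 (p. 67)]
[cite: Jacobson1989BasicAlgebraII, §3.4 eqs. (27)–(31) (pp. 110–111)] -/
theorem AntiRep.finrank_le_of_forall_commute [Nontrivial V] (hdiv : ∀ z : D, IsUnit z ∨ z = 0)
    (hdeg : Module.finrank ℚ D = Module.finrank ℚ V) (𝔤 : Submodule ℚ (Module.End ℚ V))
    (h𝔤 : ∀ X ∈ 𝔤, ∀ z : D, X * MulOpposite.unop (θ z) = MulOpposite.unop (θ z) * X) :
    Module.finrank ℚ 𝔤 ≤ Module.finrank ℚ V := by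
  classical
  obtain ⟨v₀, hv₀⟩ := exists_ne (0 : V)
  obtain ⟨e, he⟩ := RealSplitting.exists_linearEquiv_of_forall_isUnit_or_eq_zero θ hdiv hdeg hv₀
  -- evaluation at `v₁ = e 1` is injective on the commutant
  set ev : 𝔤 →ₗ[ℚ] V :=
    { toFun := fun X => (X : Module.End ℚ V) (e 1)
      map_add' := fun X X' => by simp
      map_smul' := fun c X => by simp } with hev
  have hinj : Function.Injective ev := by
    intro X X' hXX'
    apply Subtype.ext
    apply LinearMap.ext
    intro v
    obtain ⟨w, rfl⟩ := e.surjective v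
    have h1 : e w = MulOpposite.unop (θ w) (e 1) := by rw [← he w 1, one_mul]
    have hXw : ∀ Y ∈ 𝔤, Y (e w) = MulOpposite.unop (θ w) (Y (e 1)) := fun Y hY => by
      rw [h1, ← Module.End.mul_apply, h𝔤 Y hY w, Module.End.mul_apply]
    rw [hXw _ X.2, hXw _ X'.2]
    exact congrArg _ hXX'
  exact LinearMap.finrank_le_finrank_of_injective hinj

/-- **A space of SKEW operators commuting with `θ(D)` has dimension `< dim_ℚ V`** (for a non-zero bilinear
form): it lies in the commutant (dimension `≤ dim V`) and misses the identity, which commutes with everything but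
is not skew. For `S` a simple abelian surface with `dim_ℚ End⁰(S) = 4 = dim_ℚ H¹(S; ℚ)`: every admissible rational Lie
algebra of `H¹(S)` has dimension `≤ 3 = dim 𝔰𝔩₁(D°)` (Moonen–Zarhin (2.2) Type 2(1) «`Hg(X) = U_{D^opp}`»).
[cite: MoonenZarhin1999LowDim, §2 (2.2)] [cite: Murty1988, Thm. 2 (p. 67)] -/
theorem AntiRep.finrank_lt_of_forall_commute_of_skew [Nontrivial V] (hdiv : ∀ z : D, IsUnit z ∨ z = 0)
    (hdeg : Module.finrank ℚ D = Module.finrank ℚ V) (B : LinearMap.BilinForm ℚ V) (hB : B ≠ 0)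
    (𝔤 : Submodule ℚ (Module.End ℚ V))
    (h𝔤 : ∀ X ∈ 𝔤, ∀ z : D, X * MulOpposite.unop (θ z) = MulOpposite.unop (θ z) * X)
    (hskew : ∀ X ∈ 𝔤, ∀ v w, B (X v) w + B v (X w) = 0) :
    Module.finrank ℚ 𝔤 < Module.finrank ℚ V := by
  classical
  -- the commutant as a submodule
  set C : Submodule ℚ (Module.End ℚ V) :=
    { carrier := {X | ∀ z : D, X * MulOpposite.unop (θ z) = MulOpposite.unop (θ z) * X}
      zero_mem' := fun z => by simp
      add_mem' := fun {X X'} hX hX' z => by rw [add_mul, mul_add, hX z, hX' z]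
      smul_mem' := fun c X hX z => by rw [smul_mul_assoc, mul_smul_comm, hX z] } with hC
  have hCle : Module.finrank ℚ C ≤ Module.finrank ℚ V :=
    AntiRep.finrank_le_of_forall_commute θ hdiv hdeg C fun X hX => hX
  have h1C : (1 : Module.End ℚ V) ∈ C := fun z => by rw [one_mul, mul_one]
  have h1𝔤 : (1 : Module.End ℚ V) ∉ 𝔤 := by
    intro h1
    apply hB
    apply LinearMap.ext
    intro v
    apply LinearMap.ext
    intro w
    have h := hskew 1 h1 v w
    rw [Module.End.one_apply, Module.End.one_apply, ← two_smul ℚ (B v w), smul_eq_zero] at h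
    rw [LinearMap.zero_apply, LinearMap.zero_apply]
    exact h.resolve_left two_ne_zero
  have hlt : 𝔤 < C := by
    refine lt_of_le_of_ne (fun X hX => h𝔤 X hX) ?_
    intro h
    rw [h] at h1𝔤
    exact h1𝔤 h1C
  exact lt_of_lt_of_le (Submodule.finrank_lt_finrank_of_lt hlt) hCle

end LinearAlgebra

/-! ### §2 The Goursat step with an anisotropic second factor: `𝔞 ⊇ ι₁ 𝔰𝔭(V₁, ψ₁) π₁` and `𝔞 ⊇ ι₂ c₂(𝔞) π₂` -/

section Goursat

universe u

variable {U V₁ V₂ : Type u} [AddCommGroup U] [Module ℚ U] [AddCommGroup V₁] [Module ℚ V₁]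
  [AddCommGroup V₂] [Module ℚ V₂] [Module.Finite ℚ U] [Module.Finite ℚ V₁] [Module.Finite ℚ V₂] {n : ℤ}

/-- **`dim_ℂ 𝔤_ℂ ≤ dim_ℚ 𝔤`**: the complex span of a rational space of operators is spanned by the
complexifications of a `ℚ`-basis. [cite: Deligne1982HodgeCycles, I §3 (proof of Prop. 3.4)] -/
private theorem finrank_spanC_le₁ (𝔤 : Submodule ℚ (Module.End ℚ V₁)) :
    Module.finrank ℂ (spanC 𝔤) ≤ Module.finrank ℚ 𝔤 := by
  classical
  set bg := Module.finBasis ℚ 𝔤 with hbg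
  have hle : spanC 𝔤 ≤ Submodule.span ℂ (Set.range fun i => ((bg i : 𝔤) : Module.End ℚ V₁).baseChange ℂ) := by
    rw [spanC, Submodule.span_le]
    rintro _ ⟨X, hX, rfl⟩
    have hXsum : X = ∑ i, bg.repr ⟨X, hX⟩ i • ((bg i : 𝔤) : Module.End ℚ V₁) := by
      have h := congrArg Subtype.val (bg.sum_repr ⟨X, hX⟩)
      simp only [Submodule.coe_sum, Submodule.coe_smul] at h
      exact h.symm
    have hbc : (∑ i, bg.repr ⟨X, hX⟩ i • ((bg i : 𝔤) : Module.End ℚ V₁)).baseChange ℂ =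
        ∑ i, (bg.repr ⟨X, hX⟩ i • ((bg i : 𝔤) : Module.End ℚ V₁)).baseChange ℂ := by
      have h := map_sum (LinearMap.baseChangeHom ℚ ℂ V₁ V₁)
        (fun i => bg.repr ⟨X, hX⟩ i • ((bg i : 𝔤) : Module.End ℚ V₁)) Finset.univ
      simpa only [LinearMap.baseChangeHom_apply] using h
    rw [SetLike.mem_coe]
    change X.baseChange ℂ ∈ _
    rw [hXsum, hbc]
    refine Submodule.sum_mem _ fun i _ => ?_
    rw [LinearMap.baseChange_smul, ← algebraMap_smul ℂ (bg.repr ⟨X, hX⟩ i)]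
    exact Submodule.smul_mem _ _ (Submodule.subset_span ⟨i, rfl⟩)
  calc Module.finrank ℂ (spanC 𝔤)
      ≤ Module.finrank ℂ (Submodule.span ℂ (Set.range fun i => ((bg i : 𝔤) : Module.End ℚ V₁).baseChange ℂ)) :=
        Submodule.finrank_mono hle
    _ ≤ Fintype.card (Fin (Module.finrank ℚ 𝔤)) := finrank_range_le_card _
    _ = Module.finrank ℚ 𝔤 := Fintype.card_fin _

/-- **The Goursat step with an anisotropic second factor (Moonen–Zarhin (3.1) with `𝔤₃ = 0` for
`𝔰𝔩_{2,ℚ} ⊄ 𝔰𝔩₁(D°)`).** Let `U = ι₁V₁ ⊕ ι₂V₂` and let `𝔞 ⊆ End_ℚ(U)` be a bracket-closed space of block-diagonal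
operators whose first corners `c₁X = π₁ X ι₁` are `ψ₁`-skew, such that the Hodge operator `Θ₁` of `V₁` lies in the
complex span of `c₁(𝔞)`. Assume (RIGID) and (IDEAL) for `(V₁, ψ₁, Θ₁)`, a SPLIT PAIR of rational `ψ₁`-skew operators
`e ≠ 0`, `h` with `h e − e h = 2 e`, `r` independent `ψ₁`-skew operators on `V₁ ⊗ ℂ`, (ANISO): every second corner
`c₂X` (`X ∈ 𝔞`) is `0` or invertible, and (FEW): every space of second corners of `𝔞` has dimension `≤ r`. Then
`ι₁ Z π₁ ∈ 𝔞` for every rational `ψ₁`-skew `Z`, and `ι₂ c₂X π₂ ∈ 𝔞` for every `X ∈ 𝔞` — «`Hg(X₁ × X₂) =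
Hg(X₁) × Hg(X₂)`», the first factor being all of `Sp(V₁, ψ₁)`. Proof: module docstring (the kernel
`K = 𝔞 ∩ ker c₂` is non-zero since a graph would transport the split pair into invertible operators, contradicting
`false_of_commutator_eq_two_smul`; then `c₁(K)` is an ideal of `c₁(𝔞)`, (IDEAL) and (RIGID) make its complex span
everything, and descent gives rational preimages `ι₁ Z π₁ ∈ K`). [cite: MoonenZarhin1999LowDim, §3 (3.1) and Thm. (3.2)(1)]
[cite: Hazama1989, Thm. (= Gordon 7.6.2)] [cite: Deligne1982HodgeCycles, I §3 (proof of Prop. 3.4)] -/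
theorem goursat_incl_corner_mem_of_anisotropic (H₁ : HodgeStructure V₁ n)
    {ι₁ : V₁ →ₗ[ℚ] U} {π₁ : U →ₗ[ℚ] V₁} {ι₂ : V₂ →ₗ[ℚ] U} {π₂ : U →ₗ[ℚ] V₂}
    (hπι₁ : π₁ ∘ₗ ι₁ = LinearMap.id) (hπι₂ : π₂ ∘ₗ ι₂ = LinearMap.id) (hπ₁ι₂ : π₁ ∘ₗ ι₂ = 0)
    (hπ₂ι₁ : π₂ ∘ₗ ι₁ = 0) (hsum : ι₁ ∘ₗ π₁ + ι₂ ∘ₗ π₂ = LinearMap.id)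
    (𝔞 : Submodule ℚ (Module.End ℚ U)) (hbr : ∀ X ∈ 𝔞, ∀ X' ∈ 𝔞, X * X' - X' * X ∈ 𝔞)
    (hP₁ : ∀ X ∈ 𝔞, X * (ι₁ ∘ₗ π₁) = (ι₁ ∘ₗ π₁) * X) (hP₂ : ∀ X ∈ 𝔞, X * (ι₂ ∘ₗ π₂) = (ι₂ ∘ₗ π₂) * X)
    (ψ₁ : H₁.Polarization)
    (hskew₁ : ∀ X ∈ 𝔞, ∀ v w, ψ₁.form ((π₁ ∘ₗ X ∘ₗ ι₁) v) w + ψ₁.form v ((π₁ ∘ₗ X ∘ₗ ι₁) w) = 0)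
    {Θ₁ : Module.End ℂ (ℂ ⊗[ℚ] V₁)}
    (hΘ₁ : Θ₁ ∈ Submodule.span ℂ ((fun X : Module.End ℚ U => (π₁ ∘ₗ X ∘ₗ ι₁).baseChange ℂ) '' (𝔞 : Set _)))
    (hrigid : ∀ 𝔤₁ : Submodule ℚ (Module.End ℚ V₁), (∀ X ∈ 𝔤₁, ∀ X' ∈ 𝔤₁, X * X' - X' * X ∈ 𝔤₁) →
      (∀ X ∈ 𝔤₁, ∀ v w, ψ₁.form (X v) w + ψ₁.form v (X w) = 0) → Θ₁ ∈ spanC 𝔤₁ →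
      ∀ Y : Module.End ℂ (ℂ ⊗[ℚ] V₁),
        (∀ x y, ψ₁.form.baseChange ℂ (Y x) y + ψ₁.form.baseChange ℂ x (Y y) = 0) → Y ∈ spanC 𝔤₁)
    (hideal : ∀ I : Submodule ℂ (Module.End ℂ (ℂ ⊗[ℚ] V₁)),
      (∀ Y ∈ I, ∀ x y, ψ₁.form.baseChange ℂ (Y x) y + ψ₁.form.baseChange ℂ x (Y y) = 0) →
      (∀ Zc : Module.End ℂ (ℂ ⊗[ℚ] V₁),
        (∀ x y, ψ₁.form.baseChange ℂ (Zc x) y + ψ₁.form.baseChange ℂ x (Zc y) = 0) →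
          ∀ Y ∈ I, Zc * Y - Y * Zc ∈ I) → I ≠ ⊥ → Θ₁ ∈ I)
    (e h : Module.End ℚ V₁) (he0 : e ≠ 0) (heskew : ∀ v w, ψ₁.form (e v) w + ψ₁.form v (e w) = 0)
    (hhskew : ∀ v w, ψ₁.form (h v) w + ψ₁.form v (h w) = 0) (hhe : h * e - e * h = (2 : ℚ) • e)
    {r : ℕ} (Z : Fin r → Module.End ℂ (ℂ ⊗[ℚ] V₁)) (hZind : LinearIndependent ℂ Z)
    (hZskew : ∀ i x y, ψ₁.form.baseChange ℂ (Z i x) y + ψ₁.form.baseChange ℂ x (Z i y) = 0)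
    (haniso : ∀ X ∈ 𝔞, π₂ ∘ₗ X ∘ₗ ι₂ = 0 ∨ IsUnit (π₂ ∘ₗ X ∘ₗ ι₂))
    (hdim : ∀ 𝔤₂ : Submodule ℚ (Module.End ℚ V₂),
      (∀ Y ∈ 𝔤₂, ∃ X ∈ 𝔞, π₂ ∘ₗ X ∘ₗ ι₂ = Y) → Module.finrank ℚ 𝔤₂ ≤ r) :
    (∀ Z₁ : Module.End ℚ V₁, (∀ v w, ψ₁.form (Z₁ v) w + ψ₁.form v (Z₁ w) = 0) → ι₁ ∘ₗ Z₁ ∘ₗ π₁ ∈ 𝔞) ∧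
      ∀ X ∈ 𝔞, ι₂ ∘ₗ (π₂ ∘ₗ X ∘ₗ ι₂) ∘ₗ π₂ ∈ 𝔞 := by
  classical
  have hsum' : ι₂ ∘ₗ π₂ + ι₁ ∘ₗ π₁ = LinearMap.id := by rw [add_comm]; exact hsum
  -- the corner maps as linear maps
  obtain ⟨cL₁, hcL₁⟩ : ∃ L : Module.End ℚ U →ₗ[ℚ] Module.End ℚ V₁, ∀ X, L X = π₁ ∘ₗ X ∘ₗ ι₁ :=
    ⟨{ toFun := fun X => π₁ ∘ₗ X ∘ₗ ι₁
       map_add' := fun X X' => by rw [LinearMap.add_comp, LinearMap.comp_add]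
       map_smul' := fun c X => by rw [LinearMap.smul_comp, LinearMap.comp_smul, RingHom.id_apply] },
      fun X => rfl⟩
  obtain ⟨cL₂, hcL₂⟩ : ∃ L : Module.End ℚ U →ₗ[ℚ] Module.End ℚ V₂, ∀ X, L X = π₂ ∘ₗ X ∘ₗ ι₂ :=
    ⟨{ toFun := fun X => π₂ ∘ₗ X ∘ₗ ι₂
       map_add' := fun X X' => by rw [LinearMap.add_comp, LinearMap.comp_add]
       map_smul' := fun c X => by rw [LinearMap.smul_comp, LinearMap.comp_smul, RingHom.id_apply] },
      fun X => rfl⟩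
  -- corners of brackets
  have hc₁br : ∀ X ∈ 𝔞, ∀ X' ∈ 𝔞, π₁ ∘ₗ (X * X' - X' * X) ∘ₗ ι₁ =
      (π₁ ∘ₗ X ∘ₗ ι₁) * (π₁ ∘ₗ X' ∘ₗ ι₁) - (π₁ ∘ₗ X' ∘ₗ ι₁) * (π₁ ∘ₗ X ∘ₗ ι₁) := fun X hX X' hX' =>
    corner_bracket hπι₁ hπι₂ hπ₁ι₂ hsum (hP₁ X hX) (hP₂ X hX) (hP₁ X' hX') (hP₂ X' hX')
  have hc₂br : ∀ X ∈ 𝔞, ∀ X' ∈ 𝔞, π₂ ∘ₗ (X * X' - X' * X) ∘ₗ ι₂ =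
      (π₂ ∘ₗ X ∘ₗ ι₂) * (π₂ ∘ₗ X' ∘ₗ ι₂) - (π₂ ∘ₗ X' ∘ₗ ι₂) * (π₂ ∘ₗ X ∘ₗ ι₂) := fun X hX X' hX' =>
    corner_bracket hπι₂ hπι₁ hπ₂ι₁ hsum' (hP₂ X hX) (hP₁ X hX) (hP₂ X' hX') (hP₁ X' hX')
  -- the first corner algebra `𝔤₁ = c₁(𝔞)`
  set 𝔤₁ : Submodule ℚ (Module.End ℚ V₁) := 𝔞.map cL₁ with h𝔤₁
  have h𝔤₁mem : ∀ {Y}, Y ∈ 𝔤₁ ↔ ∃ X ∈ 𝔞, π₁ ∘ₗ X ∘ₗ ι₁ = Y := by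
    intro Y
    rw [h𝔤₁, Submodule.mem_map]
    simp only [hcL₁]
  have hbr𝔤₁ : ∀ Y ∈ 𝔤₁, ∀ Y' ∈ 𝔤₁, Y * Y' - Y' * Y ∈ 𝔤₁ := by
    intro Y hY Y' hY'
    obtain ⟨X, hX, rfl⟩ := h𝔤₁mem.1 hY
    obtain ⟨X', hX', rfl⟩ := h𝔤₁mem.1 hY'
    exact h𝔤₁mem.2 ⟨_, hbr X hX X' hX', hc₁br X hX X' hX'⟩
  have hskew𝔤₁ : ∀ Y ∈ 𝔤₁, ∀ v w, ψ₁.form (Y v) w + ψ₁.form v (Y w) = 0 := by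
    intro Y hY v w
    obtain ⟨X, hX, rfl⟩ := h𝔤₁mem.1 hY
    exact hskew₁ X hX v w
  have hspanC𝔤₁ : spanC 𝔤₁ = Submodule.span ℂ
      ((fun X : Module.End ℚ U => (π₁ ∘ₗ X ∘ₗ ι₁).baseChange ℂ) '' (𝔞 : Set _)) := by
    rw [spanC, h𝔤₁, Submodule.map_coe, Set.image_image]
    simp only [hcL₁]
  have hΘ𝔤₁ : Θ₁ ∈ spanC 𝔤₁ := by rw [hspanC𝔤₁]; exact hΘ₁
  -- (RIGID) for `𝔤₁`: its complex span is everything skew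
  have hfull₁ : ∀ Y : Module.End ℂ (ℂ ⊗[ℚ] V₁),
      (∀ x y, ψ₁.form.baseChange ℂ (Y x) y + ψ₁.form.baseChange ℂ x (Y y) = 0) → Y ∈ spanC 𝔤₁ :=
    hrigid 𝔤₁ hbr𝔤₁ hskew𝔤₁ hΘ𝔤₁
  -- the split pair lies in `𝔤₁` (descent)
  have he𝔤₁ : e ∈ 𝔤₁ :=
    mem_of_baseChange_mem_spanC 𝔤₁ (hfull₁ _ (ThetaSubalgebra.formBaseChange_add_eq_zero_of_skew ψ₁ heskew))
  have hh𝔤₁ : h ∈ 𝔤₁ :=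
    mem_of_baseChange_mem_spanC 𝔤₁ (hfull₁ _ (ThetaSubalgebra.formBaseChange_add_eq_zero_of_skew ψ₁ hhskew))
  obtain ⟨Xe, hXe𝔞, hXe⟩ := h𝔤₁mem.1 he𝔤₁
  obtain ⟨Xh, hXh𝔞, hXh⟩ := h𝔤₁mem.1 hh𝔤₁
  -- the kernel `K = 𝔞 ∩ ker c₂`
  set K : Submodule ℚ (Module.End ℚ U) := 𝔞 ⊓ LinearMap.ker cL₂ with hK
  have hKmem : ∀ {X}, X ∈ K ↔ X ∈ 𝔞 ∧ π₂ ∘ₗ X ∘ₗ ι₂ = 0 := by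
    intro X
    rw [hK, Submodule.mem_inf, LinearMap.mem_ker, hcL₂]
  have hKideal : ∀ X' ∈ 𝔞, ∀ X ∈ K, X' * X - X * X' ∈ K := by
    intro X' hX' X hX
    obtain ⟨hX𝔞, hc₂X⟩ := hKmem.1 hX
    refine hKmem.2 ⟨hbr X' hX' X hX𝔞, ?_⟩
    rw [hc₂br X' hX' X hX𝔞, hc₂X, mul_zero, zero_mul, sub_zero]
  -- `K ≠ 0`: otherwise `𝔞` is a graph and transports the split pair into the anisotropic corner algebra
  have hK0 : K ≠ ⊥ := by
    intro hKbot
    have hinj₂ : ∀ X ∈ 𝔞, cL₂ X = 0 → X = 0 := fun X hX h0 => by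
      have hXK : X ∈ K := hKmem.2 ⟨hX, by rw [← hcL₂]; exact h0⟩
      rw [hKbot] at hXK
      exact (Submodule.mem_bot ℚ).1 hXK
    have hker₂ : LinearMap.ker (cL₂.domRestrict 𝔞) = ⊥ := by
      rw [eq_bot_iff]
      rintro ⟨X, hX⟩ h0
      rw [LinearMap.mem_ker, LinearMap.domRestrict_apply] at h0
      rw [Submodule.mem_bot]
      exact Subtype.ext (hinj₂ X hX h0)
    have hrn₂ := LinearMap.finrank_range_add_finrank_ker (cL₂.domRestrict 𝔞)
    rw [hker₂, finrank_bot, add_zero, LinearMap.range_domRestrict] at hrn₂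
    -- the dimension count: `dim 𝔞 = dim c₂(𝔞) ≤ r ≤ dim_ℂ c₁(𝔞)_ℂ ≤ dim c₁(𝔞) ≤ dim 𝔞`
    have h1 : Module.finrank ℚ 𝔞 ≤ r := by
      rw [← hrn₂]
      refine hdim _ fun Y hY => ?_
      obtain ⟨X, hX, rfl⟩ := Submodule.mem_map.1 hY
      exact ⟨X, hX, (hcL₂ X).symm⟩
    have h2 : r ≤ Module.finrank ℂ (spanC 𝔤₁) := by
      have hZmem : ∀ i, Z i ∈ spanC 𝔤₁ := fun i => hfull₁ (Z i) (hZskew i)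
      have hind : LinearIndependent ℂ (fun i => (⟨Z i, hZmem i⟩ : spanC 𝔤₁)) :=
        LinearIndependent.of_comp (spanC 𝔤₁).subtype (by exact hZind)
      have h := hind.fintype_card_le_finrank
      rwa [Fintype.card_fin] at h
    have h3 : Module.finrank ℂ (spanC 𝔤₁) ≤ Module.finrank ℚ 𝔤₁ := finrank_spanC_le₁ 𝔤₁
    have h4 : Module.finrank ℚ 𝔤₁ ≤ Module.finrank ℚ 𝔞 := Submodule.finrank_map_le cL₁ 𝔞
    have heq₁ : Module.finrank ℚ 𝔤₁ = Module.finrank ℚ 𝔞 := by omega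
    -- hence `c₁|_𝔞` is injective as well
    have hrn₁ := LinearMap.finrank_range_add_finrank_ker (cL₁.domRestrict 𝔞)
    rw [LinearMap.range_domRestrict, ← h𝔤₁, heq₁] at hrn₁
    have hker₁ : LinearMap.ker (cL₁.domRestrict 𝔞) = ⊥ := by
      rw [← Submodule.finrank_eq_zero]
      omega
    have hinj₁ : ∀ X ∈ 𝔞, cL₁ X = 0 → X = 0 := fun X hX h0 => by
      have hXK : (⟨X, hX⟩ : 𝔞) ∈ LinearMap.ker (cL₁.domRestrict 𝔞) := by
        rw [LinearMap.mem_ker, LinearMap.domRestrict_apply]; exact h0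
      rw [hker₁, Submodule.mem_bot] at hXK
      exact congrArg Subtype.val hXK
    -- the element `B = [X_h, X_e] - 2 X_e` of `𝔞` has `c₁ B = 0`, hence vanishes
    set B : Module.End ℚ U := Xh * Xe - Xe * Xh - (2 : ℚ) • Xe with hB
    have hB𝔞 : B ∈ 𝔞 := Submodule.sub_mem _ (hbr Xh hXh𝔞 Xe hXe𝔞) (Submodule.smul_mem _ _ hXe𝔞)
    have hc₁B : cL₁ B = 0 := by
      rw [hB, map_sub, map_smul, hcL₁, hcL₁, hc₁br Xh hXh𝔞 Xe hXe𝔞, hXe, hXh, hhe, sub_self]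
    have hB0 : B = 0 := hinj₁ B hB𝔞 hc₁B
    -- so `c₂ B = [y, x] - 2 x = 0` with `x = c₂ X_e ≠ 0` invertible
    have hc₂B : (π₂ ∘ₗ Xh ∘ₗ ι₂) * (π₂ ∘ₗ Xe ∘ₗ ι₂) - (π₂ ∘ₗ Xe ∘ₗ ι₂) * (π₂ ∘ₗ Xh ∘ₗ ι₂) =
        (2 : ℚ) • (π₂ ∘ₗ Xe ∘ₗ ι₂) := by
      have h0 : cL₂ B = 0 := by rw [hB0, map_zero]
      rw [hB, map_sub, map_smul, hcL₂, hcL₂, hc₂br Xh hXh𝔞 Xe hXe𝔞] at h0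
      exact sub_eq_zero.1 h0
    have hx0 : π₂ ∘ₗ Xe ∘ₗ ι₂ ≠ 0 := by
      intro h0
      have hXe0 : Xe = 0 := hinj₂ Xe hXe𝔞 (by rw [hcL₂]; exact h0)
      apply he0
      rw [← hXe, hXe0, LinearMap.zero_comp, LinearMap.comp_zero]
    have hxunit : IsUnit (π₂ ∘ₗ Xe ∘ₗ ι₂) := (haniso Xe hXe𝔞).resolve_left hx0
    haveI : Nontrivial V₂ := by
      by_contra hV
      rw [not_nontrivial_iff_subsingleton] at hV
      exact hx0 (Subsingleton.elim _ _)
    exact false_of_commutator_eq_two_smul hxunit hc₂B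
  obtain ⟨X₀, hX₀K, hX₀ne⟩ := (Submodule.ne_bot_iff K).1 hK0
  -- the ideal `c₁(K)` and its complex span
  set 𝔤K : Submodule ℚ (Module.End ℚ V₁) := K.map cL₁ with h𝔤K
  have h𝔤Kmem : ∀ {Y}, Y ∈ 𝔤K ↔ ∃ X ∈ K, π₁ ∘ₗ X ∘ₗ ι₁ = Y := by
    intro Y
    rw [h𝔤K, Submodule.mem_map]
    simp only [hcL₁]
  have h𝔤Kle : 𝔤K ≤ 𝔤₁ := Submodule.map_mono inf_le_left
  have hideal𝔤K : ∀ Y ∈ 𝔤₁, ∀ Y' ∈ 𝔤K, Y * Y' - Y' * Y ∈ 𝔤K := by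
    intro Y hY Y' hY'
    obtain ⟨X, hX, rfl⟩ := h𝔤₁mem.1 hY
    obtain ⟨X', hX', rfl⟩ := h𝔤Kmem.1 hY'
    exact h𝔤Kmem.2 ⟨_, hKideal X hX X' hX', hc₁br X hX X' (hKmem.1 hX').1⟩
  have hskew𝔤K : ∀ Y ∈ 𝔤K, ∀ v w, ψ₁.form (Y v) w + ψ₁.form v (Y w) = 0 :=
    fun Y hY => hskew𝔤₁ Y (h𝔤Kle hY)
  have hc₁X₀ : π₁ ∘ₗ X₀ ∘ₗ ι₁ ≠ 0 := by
    intro h0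
    obtain ⟨hX₀𝔞, hc₂X₀⟩ := hKmem.1 hX₀K
    apply hX₀ne
    rw [eq_incl_corner_add hπι₁ hπι₂ hsum (hP₁ X₀ hX₀𝔞) (hP₂ X₀ hX₀𝔞), hc₂X₀, h0]
    simp only [LinearMap.zero_comp, LinearMap.comp_zero, add_zero]
  have hI0 : spanC 𝔤K ≠ ⊥ := by
    intro hbot
    apply hc₁X₀
    have hmem : (π₁ ∘ₗ X₀ ∘ₗ ι₁).baseChange ℂ ∈ spanC 𝔤K := baseChange_mem_spanC (h𝔤Kmem.2 ⟨X₀, hX₀K, rfl⟩)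
    rw [hbot, Submodule.mem_bot] at hmem
    have h : π₁ ∘ₗ X₀ ∘ₗ ι₁ ∈ (⊥ : Submodule ℚ (Module.End ℚ V₁)) :=
      mem_of_baseChange_mem_spanC ⊥ (by rw [hmem]; exact Submodule.zero_mem _)
    exact (Submodule.mem_bot ℚ).1 h
  have hIskew : ∀ Y ∈ spanC 𝔤K, ∀ x y, ψ₁.form.baseChange ℂ (Y x) y + ψ₁.form.baseChange ℂ x (Y y) = 0 :=
    fun Y hY => ThetaSubalgebra.formBaseChange_add_eq_zero_of_mem_spanC ψ₁ hskew𝔤K hY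
  have hIideal : ∀ Zc : Module.End ℂ (ℂ ⊗[ℚ] V₁),
      (∀ x y, ψ₁.form.baseChange ℂ (Zc x) y + ψ₁.form.baseChange ℂ x (Zc y) = 0) →
        ∀ Y ∈ spanC 𝔤K, Zc * Y - Y * Zc ∈ spanC 𝔤K :=
    fun Zc hZc Y hY => bracket_mem_spanC_of_forall hideal𝔤K (hfull₁ Zc hZc) hY
  -- (IDEAL): `Θ₁ ∈ c₁(K)_ℂ`; (RIGID): `c₁(K)_ℂ` is everything skew
  have hΘK : Θ₁ ∈ spanC 𝔤K := hideal _ hIskew hIideal hI0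
  have hbr𝔤K : ∀ Y ∈ 𝔤K, ∀ Y' ∈ 𝔤K, Y * Y' - Y' * Y ∈ 𝔤K := fun Y hY Y' hY' =>
    hideal𝔤K Y (h𝔤Kle hY) Y' hY'
  have hfullK : ∀ Y : Module.End ℂ (ℂ ⊗[ℚ] V₁),
      (∀ x y, ψ₁.form.baseChange ℂ (Y x) y + ψ₁.form.baseChange ℂ x (Y y) = 0) → Y ∈ spanC 𝔤K :=
    hrigid 𝔤K hbr𝔤K hskew𝔤K hΘK
  -- descent: every rational skew `Z₁` is `c₁` of an element `ι₁ Z₁ π₁` of `K`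
  have hconcl₁ : ∀ Z₁ : Module.End ℚ V₁, (∀ v w, ψ₁.form (Z₁ v) w + ψ₁.form v (Z₁ w) = 0) →
      ι₁ ∘ₗ Z₁ ∘ₗ π₁ ∈ 𝔞 := by
    intro Z₁ hZ₁
    have hmemC : Z₁.baseChange ℂ ∈ spanC 𝔤K :=
      hfullK _ (ThetaSubalgebra.formBaseChange_add_eq_zero_of_skew ψ₁ hZ₁)
    obtain ⟨X, hXK, hXeq⟩ := h𝔤Kmem.1 (mem_of_baseChange_mem_spanC 𝔤K hmemC)
    obtain ⟨hX𝔞, hc₂X⟩ := hKmem.1 hXK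
    have hdec := eq_incl_corner_add hπι₁ hπι₂ hsum (hP₁ X hX𝔞) (hP₂ X hX𝔞)
    rw [hc₂X, hXeq] at hdec
    simp only [LinearMap.zero_comp, LinearMap.comp_zero, add_zero] at hdec
    rw [← hdec]
    exact hX𝔞
  refine ⟨hconcl₁, fun X hX => ?_⟩
  have hdec := eq_incl_corner_add hπι₁ hπι₂ hsum (hP₁ X hX) (hP₂ X hX)
  have h1 : ι₁ ∘ₗ (π₁ ∘ₗ X ∘ₗ ι₁) ∘ₗ π₁ ∈ 𝔞 := hconcl₁ _ (hskew₁ X hX)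
  have heq : ι₂ ∘ₗ (π₂ ∘ₗ X ∘ₗ ι₂) ∘ₗ π₂ = X - ι₁ ∘ₗ (π₁ ∘ₗ X ∘ₗ ι₁) ∘ₗ π₁ :=
    eq_sub_of_add_eq' hdec.symm
  rw [heq]
  exact Submodule.sub_mem _ hX h1

end Goursat

/-! ### §3 The theorems: `𝔰𝔭(V₁ ⊗ ℂ) ⊕ 0` and `0 ⊕ (every admissible algebra of V₂)_ℂ` kill every rational tensor killed by `Θ_U` -/

section Main

universe u

variable {U V₁ V₂ : Type u} [AddCommGroup U] [Module ℚ U] [AddCommGroup V₁] [Module ℚ V₁]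
  [AddCommGroup V₂] [Module ℚ V₂] [Module.Finite ℚ U] [Module.Finite ℚ V₁] [Module.Finite ℚ V₂]
  [HodgeTensorFacts.{u, u}] {n : ℤ}
variable {M d m : ℕ}

omit [Module.Finite ℚ U] [HodgeTensorFacts.{u, u}] in
/-- Complexification of a sum of bilinear forms, evaluated. [cite: Deligne1982HodgeCycles, I §3 (proof of Prop. 3.4)] -/
private theorem baseChange_add_apply₁ (B B' : LinearMap.BilinForm ℚ U) (x y : ℂ ⊗[ℚ] U) :
    LinearMap.BilinForm.baseChange ℂ (B + B') x y =
      LinearMap.BilinForm.baseChange ℂ B x y + LinearMap.BilinForm.baseChange ℂ B' x y := by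
  induction x using TensorProduct.induction_on with
  | zero => simp
  | tmul c v =>
    induction y using TensorProduct.induction_on with
    | zero => simp
    | tmul d w =>
      simp only [LinearMap.BilinForm.baseChange_tmul, LinearMap.add_apply, add_smul]
    | add y y' hy hy' => rw [map_add, map_add, map_add, hy, hy']; abel
  | add x x' hx hx' =>
    rw [map_add, LinearMap.add_apply, map_add, map_add, LinearMap.add_apply, LinearMap.add_apply, hx, hx']
    abel

/-- **The core of both theorems**: for the annihilator algebra `𝔞 = annLie φ eQ aF q` of a rational tensor `q`
on `U = ι₁V₁ ⊕ ι₂V₂` killed by `Θ_U` (`φ = ψ₁(π₁·,π₁·) + ψ₂(π₂·,π₂·)`; `aF` = the Hodge endomorphisms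
`ι₂ a π₂`, `a ∈ End_Hdg(V₂)`, and the two projectors), under (RIGID), (IDEAL), (SPLIT) for `V₁` and (ANISO),
(FEW) for `V₂`: `ι₁ Z π₁ ∈ 𝔞` for all rational `ψ₁`-skew `Z`, `ι₂ c₂X π₂ ∈ 𝔞` for all `X ∈ 𝔞`, and `Θ_U ∈ 𝔞_ℂ`.
[cite: MoonenZarhin1999LowDim, §3 (3.1) and Thm. (3.2)(1)] [cite: Deligne1982HodgeCycles, I §3 (proof of Prop. 3.4)] -/
theorem incl_skew_mem_annLie_of_symplectic_times_anisotropic (HU : HodgeStructure U n)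
    (H₁ : HodgeStructure V₁ n) (H₂ : HodgeStructure V₂ n)
    {ι₁ : V₁ →ₗ[ℚ] U} {π₁ : U →ₗ[ℚ] V₁} {ι₂ : V₂ →ₗ[ℚ] U} {π₂ : U →ₗ[ℚ] V₂}
    (hπι₁ : π₁ ∘ₗ ι₁ = LinearMap.id) (hπι₂ : π₂ ∘ₗ ι₂ = LinearMap.id) (hπ₁ι₂ : π₁ ∘ₗ ι₂ = 0)
    (hπ₂ι₁ : π₂ ∘ₗ ι₁ = 0) (hsum : ι₁ ∘ₗ π₁ + ι₂ ∘ₗ π₂ = LinearMap.id)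
    (hι₁F : ∀ p, ∀ x ∈ H₁.piece p (n - p), ι₁.baseChange ℂ x ∈ HU.piece p (n - p))
    (hι₂F : ∀ p, ∀ x ∈ H₂.piece p (n - p), ι₂.baseChange ℂ x ∈ HU.piece p (n - p))
    (ψ₁ : H₁.Polarization) (ψ₂ : H₂.Polarization) {Θ₁ : Module.End ℂ (ℂ ⊗[ℚ] V₁)}
    (hΘ₁ : ∀ p, ∀ x ∈ H₁.piece p (n - p), Θ₁ x = ((2 * p - n : ℤ) : ℂ) • x)
    {Θ₂ : Module.End ℂ (ℂ ⊗[ℚ] V₂)}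
    (hΘ₂ : ∀ p, ∀ x ∈ H₂.piece p (n - p), Θ₂ x = ((2 * p - n : ℤ) : ℂ) • x)
    (hrigid : ∀ 𝔤₁ : Submodule ℚ (Module.End ℚ V₁), (∀ X ∈ 𝔤₁, ∀ X' ∈ 𝔤₁, X * X' - X' * X ∈ 𝔤₁) →
      (∀ X ∈ 𝔤₁, ∀ v w, ψ₁.form (X v) w + ψ₁.form v (X w) = 0) → Θ₁ ∈ spanC 𝔤₁ →
      ∀ Y : Module.End ℂ (ℂ ⊗[ℚ] V₁),
        (∀ x y, ψ₁.form.baseChange ℂ (Y x) y + ψ₁.form.baseChange ℂ x (Y y) = 0) → Y ∈ spanC 𝔤₁)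
    (hideal : ∀ I : Submodule ℂ (Module.End ℂ (ℂ ⊗[ℚ] V₁)),
      (∀ Y ∈ I, ∀ x y, ψ₁.form.baseChange ℂ (Y x) y + ψ₁.form.baseChange ℂ x (Y y) = 0) →
      (∀ Zc : Module.End ℂ (ℂ ⊗[ℚ] V₁),
        (∀ x y, ψ₁.form.baseChange ℂ (Zc x) y + ψ₁.form.baseChange ℂ x (Zc y) = 0) →
          ∀ Y ∈ I, Zc * Y - Y * Zc ∈ I) → I ≠ ⊥ → Θ₁ ∈ I)
    (e h : Module.End ℚ V₁) (he0 : e ≠ 0) (heskew : ∀ v w, ψ₁.form (e v) w + ψ₁.form v (e w) = 0)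
    (hhskew : ∀ v w, ψ₁.form (h v) w + ψ₁.form v (h w) = 0) (hhe : h * e - e * h = (2 : ℚ) • e)
    {r : ℕ} (Z : Fin r → Module.End ℂ (ℂ ⊗[ℚ] V₁)) (hZind : LinearIndependent ℂ Z)
    (hZskew : ∀ i x y, ψ₁.form.baseChange ℂ (Z i x) y + ψ₁.form.baseChange ℂ x (Z i y) = 0)
    (haniso : ∀ X : Module.End ℚ V₂,
      (∀ a : H₂.endAlg, X * (a : Module.End ℚ V₂) = (a : Module.End ℚ V₂) * X) → X = 0 ∨ IsUnit X)
    (hdim : ∀ 𝔤₂ : Submodule ℚ (Module.End ℚ V₂),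
      (∀ Y ∈ 𝔤₂, ∀ a : H₂.endAlg, Y * (a : Module.End ℚ V₂) = (a : Module.End ℚ V₂) * Y) →
      (∀ Y ∈ 𝔤₂, ∀ v w, ψ₂.form (Y v) w + ψ₂.form v (Y w) = 0) → Module.finrank ℚ 𝔤₂ ≤ r)
    (eQ : Module.Basis (Fin M) ℚ U) (q : (Fin d → Fin m × Fin M) → ℚ)
    {ΘU : Module.End ℂ (ℂ ⊗[ℚ] U)} (hΘU : ∀ p, ∀ x ∈ HU.piece p (n - p), ΘU x = ((2 * p - n : ℤ) : ℂ) • x)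
    (hΘq : ∀ u : Fin d → Fin m, wordDerAt ℂ (fun _ : Fin d =>
      LinearMap.toMatrix (Algebra.TensorProduct.basis ℂ eQ) (Algebra.TensorProduct.basis ℂ eQ) ΘU)
      (wordSlice (fun w => algebraMap ℚ ℂ (q w)) u) = 0) :
    (∀ Z₁ : Module.End ℚ V₁, (∀ v w, ψ₁.form (Z₁ v) w + ψ₁.form v (Z₁ w) = 0) →
      ι₁ ∘ₗ Z₁ ∘ₗ π₁ ∈ annLie (ψ₁.form.compl₁₂ π₁ π₁ + ψ₂.form.compl₁₂ π₂ π₂) eQ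
        (Sum.elim (fun a : H₂.endAlg => ι₂ ∘ₗ (a : Module.End ℚ V₂) ∘ₗ π₂)
          (Sum.elim (fun _ : Unit => ι₁ ∘ₗ π₁) (fun _ : Unit => ι₂ ∘ₗ π₂))) q) ∧
    (∀ X ∈ annLie (ψ₁.form.compl₁₂ π₁ π₁ + ψ₂.form.compl₁₂ π₂ π₂) eQ
        (Sum.elim (fun a : H₂.endAlg => ι₂ ∘ₗ (a : Module.End ℚ V₂) ∘ₗ π₂)
          (Sum.elim (fun _ : Unit => ι₁ ∘ₗ π₁) (fun _ : Unit => ι₂ ∘ₗ π₂))) q,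
      ι₂ ∘ₗ (π₂ ∘ₗ X ∘ₗ ι₂) ∘ₗ π₂ ∈ annLie (ψ₁.form.compl₁₂ π₁ π₁ + ψ₂.form.compl₁₂ π₂ π₂) eQ
        (Sum.elim (fun a : H₂.endAlg => ι₂ ∘ₗ (a : Module.End ℚ V₂) ∘ₗ π₂)
          (Sum.elim (fun _ : Unit => ι₁ ∘ₗ π₁) (fun _ : Unit => ι₂ ∘ₗ π₂))) q) ∧
    ΘU ∈ spanC (annLie (ψ₁.form.compl₁₂ π₁ π₁ + ψ₂.form.compl₁₂ π₂ π₂) eQ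
        (Sum.elim (fun a : H₂.endAlg => ι₂ ∘ₗ (a : Module.End ℚ V₂) ∘ₗ π₂)
          (Sum.elim (fun _ : Unit => ι₁ ∘ₗ π₁) (fun _ : Unit => ι₂ ∘ₗ π₂))) q) := by
  classical
  have hΘ₁C : Θ₁ ∈ H₁.hodgeLieC := H₁.mem_hodgeLieC_of_forall_piece hΘ₁
  have hΘ₂C : Θ₂ ∈ H₂.hodgeLieC := H₂.mem_hodgeLieC_of_forall_piece hΘ₂
  have hsum' : ι₂ ∘ₗ π₂ + ι₁ ∘ₗ π₁ = LinearMap.id := by rw [add_comm]; exact hsum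
  have e11 : ∀ v, π₁ (ι₁ v) = v := fun v => by
    rw [← LinearMap.comp_apply (f := π₁), hπι₁, LinearMap.id_apply]
  have e22 : ∀ w, π₂ (ι₂ w) = w := fun w => by
    rw [← LinearMap.comp_apply (f := π₂), hπι₂, LinearMap.id_apply]
  have e12 : ∀ w, π₁ (ι₂ w) = 0 := fun w => by
    rw [← LinearMap.comp_apply (f := π₁), hπ₁ι₂, LinearMap.zero_apply]
  have e21 : ∀ v, π₂ (ι₁ v) = 0 := fun v => by
    rw [← LinearMap.comp_apply (f := π₂), hπ₂ι₁, LinearMap.zero_apply]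
  -- `Θ` through the presentation
  have hΘι₁ := theta_incl_eq HU H₁ hι₁F hΘU hΘ₁
  have hΘι₂ := theta_incl_eq HU H₂ hι₂F hΘU hΘ₂
  have hΘπ₁ := proj_theta_eq HU H₁ H₂ hπι₁ hπ₁ι₂ hsum hι₁F hι₂F hΘU hΘ₁ hΘ₂
  have hΘπ₂ := proj_theta_eq HU H₂ H₁ hπι₂ hπ₂ι₁ hsum' hι₂F hι₁F hΘU hΘ₂ hΘ₁
  -- the commuting family and the orthogonal-sum form
  set aF : H₂.endAlg ⊕ (Unit ⊕ Unit) → Module.End ℚ U :=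
    Sum.elim (fun a : H₂.endAlg => ι₂ ∘ₗ (a : Module.End ℚ V₂) ∘ₗ π₂)
      (Sum.elim (fun _ : Unit => ι₁ ∘ₗ π₁) (fun _ : Unit => ι₂ ∘ₗ π₂)) with haF
  set φ : LinearMap.BilinForm ℚ U := ψ₁.form.compl₁₂ π₁ π₁ + ψ₂.form.compl₁₂ π₂ π₂ with hφ
  have hφC : ∀ x y, φ.baseChange ℂ x y = ψ₁.form.baseChange ℂ (π₁.baseChange ℂ x) (π₁.baseChange ℂ y) +
      ψ₂.form.baseChange ℂ (π₂.baseChange ℂ x) (π₂.baseChange ℂ y) := fun x y => by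
    rw [hφ, baseChange_add_apply₁, baseChange_compl₁₂_apply, baseChange_compl₁₂_apply]
  have hφapply : ∀ x y, φ x y = ψ₁.form (π₁ x) (π₁ y) + ψ₂.form (π₂ x) (π₂ y) := fun x y => by
    rw [hφ, LinearMap.add_apply, LinearMap.add_apply, LinearMap.compl₁₂_apply, LinearMap.compl₁₂_apply]
  set 𝔞 : Submodule ℚ (Module.End ℚ U) := annLie φ eQ aF q with h𝔞
  -- `Θ_U ∈ 𝔞_ℂ`
  have hΘ𝔞 : ΘU ∈ spanC 𝔞 := by
    refine mem_spanC_annLie φ eQ aF q hΘq (fun i => ?_) (fun x y => ?_)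
    · apply LinearMap.ext
      intro y
      rcases i with a | (_ | _)
      · change ΘU ((ι₂ ∘ₗ (a : Module.End ℚ V₂) ∘ₗ π₂).baseChange ℂ y) =
          (ι₂ ∘ₗ (a : Module.End ℚ V₂) ∘ₗ π₂).baseChange ℂ (ΘU y)
        simp only [LinearMap.baseChange_comp, LinearMap.comp_apply]
        rw [hΘι₂, ← Module.End.mul_apply (f := Θ₂), commute_baseChange_of_mem_hodgeLieC H₂ hΘ₂C a,
          Module.End.mul_apply, hΘπ₂]
      · change ΘU ((ι₁ ∘ₗ π₁).baseChange ℂ y) = (ι₁ ∘ₗ π₁).baseChange ℂ (ΘU y)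
        simp only [LinearMap.baseChange_comp, LinearMap.comp_apply]
        rw [hΘι₁, hΘπ₁]
      · change ΘU ((ι₂ ∘ₗ π₂).baseChange ℂ y) = (ι₂ ∘ₗ π₂).baseChange ℂ (ΘU y)
        simp only [LinearMap.baseChange_comp, LinearMap.comp_apply]
        rw [hΘι₂, hΘπ₂]
    · rw [hφC, hφC, hΘπ₁, hΘπ₁, hΘπ₂, hΘπ₂, formBaseChange_skew_of_mem_hodgeLieC ψ₁ hΘ₁C,
        formBaseChange_skew_of_mem_hodgeLieC ψ₂ hΘ₂C]
      ring
  -- what membership in `𝔞` gives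
  have hbr𝔞 : ∀ X ∈ 𝔞, ∀ X' ∈ 𝔞, X * X' - X' * X ∈ 𝔞 := fun X hX X' hX' =>
    commutator_mem_annLie φ eQ aF q hX hX'
  have hmem : ∀ X ∈ 𝔞, (∀ i, X * aF i = aF i * X) ∧ ∀ v w, φ (X v) w + φ v (X w) = 0 :=
    fun X hX => ((mem_annLie_iff φ eQ aF q X).1 hX).2
  have hP₁ : ∀ X ∈ 𝔞, X * (ι₁ ∘ₗ π₁) = (ι₁ ∘ₗ π₁) * X := fun X hX => (hmem X hX).1 (Sum.inr (Sum.inl ()))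
  have hP₂ : ∀ X ∈ 𝔞, X * (ι₂ ∘ₗ π₂) = (ι₂ ∘ₗ π₂) * X := fun X hX => (hmem X hX).1 (Sum.inr (Sum.inr ()))
  have hTa : ∀ X ∈ 𝔞, ∀ a : H₂.endAlg, X * (ι₂ ∘ₗ (a : Module.End ℚ V₂) ∘ₗ π₂) =
      (ι₂ ∘ₗ (a : Module.End ℚ V₂) ∘ₗ π₂) * X := fun X hX a => (hmem X hX).1 (Sum.inl a)
  have hc₂comm : ∀ X ∈ 𝔞, ∀ a : H₂.endAlg, (π₂ ∘ₗ X ∘ₗ ι₂) * (a : Module.End ℚ V₂) =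
      (a : Module.End ℚ V₂) * (π₂ ∘ₗ X ∘ₗ ι₂) := by
    intro X hX a
    apply LinearMap.ext
    intro v
    have h := congrArg (fun f : Module.End ℚ U => π₂ (f (ι₂ v))) (hTa X hX a)
    simp only [Module.End.mul_apply, LinearMap.comp_apply, e22] at h
    simp only [Module.End.mul_apply, LinearMap.comp_apply]
    exact h
  have hc₁skew : ∀ X ∈ 𝔞, ∀ v w, ψ₁.form ((π₁ ∘ₗ X ∘ₗ ι₁) v) w + ψ₁.form v ((π₁ ∘ₗ X ∘ₗ ι₁) w) = 0 := by
    intro X hX v w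
    have h := (hmem X hX).2 (ι₁ v) (ι₁ w)
    rw [apply_incl_eq_of_commute_projector hπι₁ (hP₁ X hX) v,
      apply_incl_eq_of_commute_projector hπι₁ (hP₁ X hX) w, hφapply, hφapply] at h
    simp only [e11, e21, map_zero, add_zero] at h
    simpa only [LinearMap.comp_apply] using h
  have hc₂skew : ∀ X ∈ 𝔞, ∀ v w, ψ₂.form ((π₂ ∘ₗ X ∘ₗ ι₂) v) w + ψ₂.form v ((π₂ ∘ₗ X ∘ₗ ι₂) w) = 0 := by
    intro X hX v w
    have h := (hmem X hX).2 (ι₂ v) (ι₂ w)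
    rw [apply_incl_eq_of_commute_projector hπι₂ (hP₂ X hX) v,
      apply_incl_eq_of_commute_projector hπι₂ (hP₂ X hX) w, hφapply, hφapply] at h
    simp only [e22, e12, map_zero, zero_add] at h
    simpa only [LinearMap.comp_apply] using h
  -- `Θ₁ = c₁(Θ_U)` lies in the complex span of the first corners
  have hcorner₁ : ∀ T ∈ spanC 𝔞, π₁.baseChange ℂ ∘ₗ T ∘ₗ ι₁.baseChange ℂ ∈
      Submodule.span ℂ ((fun X : Module.End ℚ U => (π₁ ∘ₗ X ∘ₗ ι₁).baseChange ℂ) '' (𝔞 : Set _)) := by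
    intro T hT
    induction hT using Submodule.span_induction with
    | mem Z' hZ' =>
      obtain ⟨X, hX, rfl⟩ := hZ'
      rw [← LinearMap.baseChange_comp, ← LinearMap.baseChange_comp]
      exact Submodule.subset_span ⟨X, hX, rfl⟩
    | zero => rw [LinearMap.zero_comp, LinearMap.comp_zero]; exact Submodule.zero_mem _
    | add Z' Z'' _ _ hZ' hZ'' => rw [LinearMap.add_comp, LinearMap.comp_add]; exact Submodule.add_mem _ hZ' hZ''
    | smul c Z' _ hZ' => rw [LinearMap.smul_comp, LinearMap.comp_smul]; exact Submodule.smul_mem _ c hZ'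
  have hΘ₁corner : Θ₁ ∈
      Submodule.span ℂ ((fun X : Module.End ℚ U => (π₁ ∘ₗ X ∘ₗ ι₁).baseChange ℂ) '' (𝔞 : Set _)) := by
    have h : Θ₁ = π₁.baseChange ℂ ∘ₗ ΘU ∘ₗ ι₁.baseChange ℂ := by
      apply LinearMap.ext
      intro x
      rw [LinearMap.comp_apply, LinearMap.comp_apply, hΘι₁, proj_incl_baseChange hπι₁]
    rw [h]
    exact hcorner₁ ΘU hΘ𝔞
  -- (ANISO) and (FEW) in the form used by the Goursat step
  have haniso' : ∀ X ∈ 𝔞, π₂ ∘ₗ X ∘ₗ ι₂ = 0 ∨ IsUnit (π₂ ∘ₗ X ∘ₗ ι₂) :=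
    fun X hX => haniso _ (hc₂comm X hX)
  have hdim' : ∀ 𝔤₂ : Submodule ℚ (Module.End ℚ V₂),
      (∀ Y ∈ 𝔤₂, ∃ X ∈ 𝔞, π₂ ∘ₗ X ∘ₗ ι₂ = Y) → Module.finrank ℚ 𝔤₂ ≤ r := by
    intro 𝔤₂ h𝔤₂
    refine hdim 𝔤₂ (fun Y hY a => ?_) (fun Y hY v w => ?_)
    · obtain ⟨X, hX, rfl⟩ := h𝔤₂ Y hY
      exact hc₂comm X hX a
    · obtain ⟨X, hX, rfl⟩ := h𝔤₂ Y hY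
      exact hc₂skew X hX v w
  obtain ⟨h1, h2⟩ := goursat_incl_corner_mem_of_anisotropic H₁ hπι₁ hπι₂ hπ₁ι₂ hπ₂ι₁ hsum 𝔞 hbr𝔞 hP₁ hP₂ ψ₁
    hc₁skew hΘ₁corner hrigid hideal e h he0 heskew hhskew hhe Z hZind hZskew haniso' hdim'
  exact ⟨h1, h2, hΘ𝔞⟩

/-- **Theorem (Hazama 1989 / Moonen–Zarhin 1999 Thm. (3.2)(1), Lie step, in the word model; first factor):
the rational tensor is killed by `ι₁ ∘ Y ∘ π₁` for EVERY `ψ₁`-skew operator `Y` of `V₁ ⊗ ℂ`** —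
`𝔰𝔭(V₁ ⊗ ℂ, ψ₁) ⊕ 0 ⊆ 𝔞(q)_ℂ` («`Hg(X₁ × X₂) ⊇ Hg(X₁) × 1 = Sp(V₁, ψ₁) × 1`» read on tensors). Setting: a
presentation `U = ι₁V₁ ⊕ ι₂V₂` compatible with Hodge structures `H_U`, `H₁`, `H₂` of the same weight; on `V₁` a
polarization `ψ₁` and a Hodge operator `Θ₁` satisfying (RIGID), (IDEAL), (SPLIT) and carrying `r` independent
skew operators after `⊗ ℂ`; on `V₂` a polarization `ψ₂`, a Hodge operator `Θ₂`, (ANISO) and (FEW) (module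
docstring; all are theorems of the tree for `V₁ = H¹` of a non-CM elliptic curve and `V₂ = H¹` of a simple abelian
surface with `dim_ℚ End⁰ = 4`). [cite: MoonenZarhin1999LowDim, §3 Thm. (3.2)(1)] [cite: Hazama1989, Thm. (= Gordon 7.6.2)]
[cite: Deligne1982HodgeCycles, I §3 (proof of Prop. 3.4)] -/
theorem wordDerAt_incl₁_eq_zero_of_symplectic_times_anisotropic (HU : HodgeStructure U n)
    (H₁ : HodgeStructure V₁ n) (H₂ : HodgeStructure V₂ n)
    {ι₁ : V₁ →ₗ[ℚ] U} {π₁ : U →ₗ[ℚ] V₁} {ι₂ : V₂ →ₗ[ℚ] U} {π₂ : U →ₗ[ℚ] V₂}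
    (hπι₁ : π₁ ∘ₗ ι₁ = LinearMap.id) (hπι₂ : π₂ ∘ₗ ι₂ = LinearMap.id) (hπ₁ι₂ : π₁ ∘ₗ ι₂ = 0)
    (hπ₂ι₁ : π₂ ∘ₗ ι₁ = 0) (hsum : ι₁ ∘ₗ π₁ + ι₂ ∘ₗ π₂ = LinearMap.id)
    (hι₁F : ∀ p, ∀ x ∈ H₁.piece p (n - p), ι₁.baseChange ℂ x ∈ HU.piece p (n - p))
    (hι₂F : ∀ p, ∀ x ∈ H₂.piece p (n - p), ι₂.baseChange ℂ x ∈ HU.piece p (n - p))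
    (ψ₁ : H₁.Polarization) (ψ₂ : H₂.Polarization) {Θ₁ : Module.End ℂ (ℂ ⊗[ℚ] V₁)}
    (hΘ₁ : ∀ p, ∀ x ∈ H₁.piece p (n - p), Θ₁ x = ((2 * p - n : ℤ) : ℂ) • x)
    {Θ₂ : Module.End ℂ (ℂ ⊗[ℚ] V₂)}
    (hΘ₂ : ∀ p, ∀ x ∈ H₂.piece p (n - p), Θ₂ x = ((2 * p - n : ℤ) : ℂ) • x)
    (hrigid : ∀ 𝔤₁ : Submodule ℚ (Module.End ℚ V₁), (∀ X ∈ 𝔤₁, ∀ X' ∈ 𝔤₁, X * X' - X' * X ∈ 𝔤₁) →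
      (∀ X ∈ 𝔤₁, ∀ v w, ψ₁.form (X v) w + ψ₁.form v (X w) = 0) → Θ₁ ∈ spanC 𝔤₁ →
      ∀ Y : Module.End ℂ (ℂ ⊗[ℚ] V₁),
        (∀ x y, ψ₁.form.baseChange ℂ (Y x) y + ψ₁.form.baseChange ℂ x (Y y) = 0) → Y ∈ spanC 𝔤₁)
    (hideal : ∀ I : Submodule ℂ (Module.End ℂ (ℂ ⊗[ℚ] V₁)),
      (∀ Y ∈ I, ∀ x y, ψ₁.form.baseChange ℂ (Y x) y + ψ₁.form.baseChange ℂ x (Y y) = 0) →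
      (∀ Zc : Module.End ℂ (ℂ ⊗[ℚ] V₁),
        (∀ x y, ψ₁.form.baseChange ℂ (Zc x) y + ψ₁.form.baseChange ℂ x (Zc y) = 0) →
          ∀ Y ∈ I, Zc * Y - Y * Zc ∈ I) → I ≠ ⊥ → Θ₁ ∈ I)
    (e h : Module.End ℚ V₁) (he0 : e ≠ 0) (heskew : ∀ v w, ψ₁.form (e v) w + ψ₁.form v (e w) = 0)
    (hhskew : ∀ v w, ψ₁.form (h v) w + ψ₁.form v (h w) = 0) (hhe : h * e - e * h = (2 : ℚ) • e)
    {r : ℕ} (Z : Fin r → Module.End ℂ (ℂ ⊗[ℚ] V₁)) (hZind : LinearIndependent ℂ Z)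
    (hZskew : ∀ i x y, ψ₁.form.baseChange ℂ (Z i x) y + ψ₁.form.baseChange ℂ x (Z i y) = 0)
    (haniso : ∀ X : Module.End ℚ V₂,
      (∀ a : H₂.endAlg, X * (a : Module.End ℚ V₂) = (a : Module.End ℚ V₂) * X) → X = 0 ∨ IsUnit X)
    (hdim : ∀ 𝔤₂ : Submodule ℚ (Module.End ℚ V₂),
      (∀ Y ∈ 𝔤₂, ∀ a : H₂.endAlg, Y * (a : Module.End ℚ V₂) = (a : Module.End ℚ V₂) * Y) →
      (∀ Y ∈ 𝔤₂, ∀ v w, ψ₂.form (Y v) w + ψ₂.form v (Y w) = 0) → Module.finrank ℚ 𝔤₂ ≤ r)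
    (eQ : Module.Basis (Fin M) ℚ U) (q : (Fin d → Fin m × Fin M) → ℚ)
    {ΘU : Module.End ℂ (ℂ ⊗[ℚ] U)} (hΘU : ∀ p, ∀ x ∈ HU.piece p (n - p), ΘU x = ((2 * p - n : ℤ) : ℂ) • x)
    (hΘq : ∀ u : Fin d → Fin m, wordDerAt ℂ (fun _ : Fin d =>
      LinearMap.toMatrix (Algebra.TensorProduct.basis ℂ eQ) (Algebra.TensorProduct.basis ℂ eQ) ΘU)
      (wordSlice (fun w => algebraMap ℚ ℂ (q w)) u) = 0)
    {Y : Module.End ℂ (ℂ ⊗[ℚ] V₁)}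
    (hY : ∀ x y, ψ₁.form.baseChange ℂ (Y x) y + ψ₁.form.baseChange ℂ x (Y y) = 0) (u : Fin d → Fin m) :
    wordDerAt ℂ (fun _ : Fin d =>
      LinearMap.toMatrix (Algebra.TensorProduct.basis ℂ eQ) (Algebra.TensorProduct.basis ℂ eQ)
        (ι₁.baseChange ℂ ∘ₗ Y ∘ₗ π₁.baseChange ℂ))
      (wordSlice (fun w => algebraMap ℚ ℂ (q w)) u) = 0 := by
  classical
  set aF : H₂.endAlg ⊕ (Unit ⊕ Unit) → Module.End ℚ U :=
    Sum.elim (fun a : H₂.endAlg => ι₂ ∘ₗ (a : Module.End ℚ V₂) ∘ₗ π₂)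
      (Sum.elim (fun _ : Unit => ι₁ ∘ₗ π₁) (fun _ : Unit => ι₂ ∘ₗ π₂)) with haF
  set φ : LinearMap.BilinForm ℚ U := ψ₁.form.compl₁₂ π₁ π₁ + ψ₂.form.compl₁₂ π₂ π₂ with hφ
  set 𝔞 : Submodule ℚ (Module.End ℚ U) := annLie φ eQ aF q with h𝔞
  obtain ⟨h1, -, hΘ𝔞⟩ := incl_skew_mem_annLie_of_symplectic_times_anisotropic HU H₁ H₂ hπι₁ hπι₂ hπ₁ι₂ hπ₂ι₁
    hsum hι₁F hι₂F ψ₁ ψ₂ hΘ₁ hΘ₂ hrigid hideal e h he0 heskew hhskew hhe Z hZind hZskew haniso hdim eQ q hΘU hΘq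
  -- the rational Lie algebra of all `ψ₁`-skew operators and (RIGID) for it
  let 𝔰 : Submodule ℚ (Module.End ℚ V₁) :=
    { carrier := {X | ∀ v w, ψ₁.form (X v) w + ψ₁.form v (X w) = 0}
      zero_mem' := fun v w => by simp
      add_mem' := by
        intro X X' hX hX' v w
        simp only [LinearMap.add_apply, map_add]
        have h1 := hX v w
        have h2 := hX' v w
        linear_combination h1 + h2
      smul_mem' := by
        intro c X hX v w
        simp only [LinearMap.smul_apply, map_smul, smul_eq_mul]
        have h1 := hX v w
        linear_combination c * h1 }
  have hmem𝔰 : ∀ X, X ∈ 𝔰 ↔ ∀ v w, ψ₁.form (X v) w + ψ₁.form v (X w) = 0 := fun X => Iff.rfl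
  have h𝔰br : ∀ X ∈ 𝔰, ∀ X' ∈ 𝔰, X * X' - X' * X ∈ 𝔰 := by
    intro X hX X' hX'
    rw [hmem𝔰] at hX hX' ⊢
    intro v w
    simp only [LinearMap.sub_apply, Module.End.mul_apply, map_sub, LinearMap.sub_apply]
    have h1 := hX (X' v) w
    have h2 := hX' v (X w)
    have h3 := hX' (X v) w
    have h4 := hX v (X' w)
    linear_combination h1 - h3 + h4 - h2
  have h𝔰skew : ∀ X ∈ 𝔰, ∀ v w, ψ₁.form (X v) w + ψ₁.form v (X w) = 0 := fun X hX => (hmem𝔰 X).1 hX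
  -- `Θ₁ ∈ 𝔰_ℂ`: the first corners of `𝔞` are `ψ₁`-skew and `Θ₁ = c₁ Θ_U`
  have hΘι₁ := theta_incl_eq HU H₁ hι₁F hΘU hΘ₁
  have e11 : ∀ v, π₁ (ι₁ v) = v := fun v => by
    rw [← LinearMap.comp_apply (f := π₁), hπι₁, LinearMap.id_apply]
  have e21 : ∀ v, π₂ (ι₁ v) = 0 := fun v => by
    rw [← LinearMap.comp_apply (f := π₂), hπ₂ι₁, LinearMap.zero_apply]
  have hmem : ∀ X ∈ 𝔞, (∀ i, X * aF i = aF i * X) ∧ ∀ v w, φ (X v) w + φ v (X w) = 0 :=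
    fun X hX => ((mem_annLie_iff φ eQ aF q X).1 hX).2
  have hP₁ : ∀ X ∈ 𝔞, X * (ι₁ ∘ₗ π₁) = (ι₁ ∘ₗ π₁) * X := fun X hX => (hmem X hX).1 (Sum.inr (Sum.inl ()))
  have hφapply : ∀ x y, φ x y = ψ₁.form (π₁ x) (π₁ y) + ψ₂.form (π₂ x) (π₂ y) := fun x y => by
    rw [hφ, LinearMap.add_apply, LinearMap.add_apply, LinearMap.compl₁₂_apply, LinearMap.compl₁₂_apply]
  have hc₁𝔰 : ∀ X ∈ 𝔞, π₁ ∘ₗ X ∘ₗ ι₁ ∈ 𝔰 := by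
    intro X hX
    rw [hmem𝔰]
    intro v w
    have h := (hmem X hX).2 (ι₁ v) (ι₁ w)
    rw [apply_incl_eq_of_commute_projector hπι₁ (hP₁ X hX) v,
      apply_incl_eq_of_commute_projector hπι₁ (hP₁ X hX) w, hφapply, hφapply] at h
    simp only [e11, e21, map_zero, add_zero] at h
    simpa only [LinearMap.comp_apply] using h
  have hcorner₁ : ∀ T ∈ spanC 𝔞, π₁.baseChange ℂ ∘ₗ T ∘ₗ ι₁.baseChange ℂ ∈ spanC 𝔰 := by
    intro T hT
    induction hT using Submodule.span_induction with
    | mem Z' hZ' =>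
      obtain ⟨X, hX, rfl⟩ := hZ'
      rw [← LinearMap.baseChange_comp, ← LinearMap.baseChange_comp]
      exact baseChange_mem_spanC (hc₁𝔰 X hX)
    | zero => rw [LinearMap.zero_comp, LinearMap.comp_zero]; exact Submodule.zero_mem _
    | add Z' Z'' _ _ hZ' hZ'' => rw [LinearMap.add_comp, LinearMap.comp_add]; exact Submodule.add_mem _ hZ' hZ''
    | smul c Z' _ hZ' => rw [LinearMap.smul_comp, LinearMap.comp_smul]; exact Submodule.smul_mem _ c hZ'
  have hΘ𝔰 : Θ₁ ∈ spanC 𝔰 := by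
    have h : Θ₁ = π₁.baseChange ℂ ∘ₗ ΘU ∘ₗ ι₁.baseChange ℂ := by
      apply LinearMap.ext
      intro x
      rw [LinearMap.comp_apply, LinearMap.comp_apply, hΘι₁, proj_incl_baseChange hπι₁]
    rw [h]
    exact hcorner₁ ΘU hΘ𝔞
  have hY𝔰 : Y ∈ spanC 𝔰 := hrigid 𝔰 h𝔰br h𝔰skew hΘ𝔰 Y hY
  -- elements of `𝔰_ℂ`, placed on `V₁`, lie in `𝔞_ℂ`
  have hplace : ∀ Y' ∈ spanC 𝔰, ι₁.baseChange ℂ ∘ₗ Y' ∘ₗ π₁.baseChange ℂ ∈ spanC 𝔞 := by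
    intro Y' hY'
    induction hY' using Submodule.span_induction with
    | mem Y₁ hY₁ =>
      obtain ⟨X, hX, rfl⟩ := hY₁
      rw [← LinearMap.baseChange_comp, ← LinearMap.baseChange_comp]
      exact baseChange_mem_spanC (h1 X ((hmem𝔰 X).1 hX))
    | zero => rw [LinearMap.zero_comp, LinearMap.comp_zero]; exact Submodule.zero_mem _
    | add Y₁ Y₂ _ _ hY₁ hY₂ => rw [LinearMap.add_comp, LinearMap.comp_add]; exact Submodule.add_mem _ hY₁ hY₂
    | smul c Y₁ _ hY₁ => rw [LinearMap.smul_comp, LinearMap.comp_smul]; exact Submodule.smul_mem _ c hY₁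
  exact wordDerAt_eq_zero_of_mem_spanC_annLie φ eQ aF q (hplace _ hY𝔰) u

/-- **Theorem (second factor): the rational tensor is killed by `ι₂ ∘ W ∘ π₂` for every operator `W` of
`V₂ ⊗ ℂ` lying in the complex span of EVERY admissible algebra of `V₂`** (bracket-closed rational `ψ₂`-skew
`𝔤₂ ⊆ End_ℚ(V₂)` commuting with `End_Hdg(V₂)` with `Θ₂ ∈ (𝔤₂)_ℂ`) — «`Hg(X₁ × X₂) ⊇ 1 × Hg(X₂)`» read on
tensors: the second corner algebra `c₂(𝔞)` is admissible and `ι₂ c₂(𝔞) π₂ ⊆ 𝔞`. For `V₂ = H¹` of a simple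
abelian surface with quaternionic multiplication the admissible algebras all complexify to the glued
`𝔰𝔩(W) ⊗ 1` (`RealSplitting.exists_glued_adapted_blockBasis`, Moonen–Zarhin (2.2) Type 2(1)).
[cite: MoonenZarhin1999LowDim, §3 Thm. (3.2)(1)] [cite: Hazama1989, Thm. (= Gordon 7.6.2)]
[cite: Deligne1982HodgeCycles, I §3 (proof of Prop. 3.4)] -/
theorem wordDerAt_incl₂_eq_zero_of_symplectic_times_anisotropic (HU : HodgeStructure U n)
    (H₁ : HodgeStructure V₁ n) (H₂ : HodgeStructure V₂ n)
    {ι₁ : V₁ →ₗ[ℚ] U} {π₁ : U →ₗ[ℚ] V₁} {ι₂ : V₂ →ₗ[ℚ] U} {π₂ : U →ₗ[ℚ] V₂}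
    (hπι₁ : π₁ ∘ₗ ι₁ = LinearMap.id) (hπι₂ : π₂ ∘ₗ ι₂ = LinearMap.id) (hπ₁ι₂ : π₁ ∘ₗ ι₂ = 0)
    (hπ₂ι₁ : π₂ ∘ₗ ι₁ = 0) (hsum : ι₁ ∘ₗ π₁ + ι₂ ∘ₗ π₂ = LinearMap.id)
    (hι₁F : ∀ p, ∀ x ∈ H₁.piece p (n - p), ι₁.baseChange ℂ x ∈ HU.piece p (n - p))
    (hι₂F : ∀ p, ∀ x ∈ H₂.piece p (n - p), ι₂.baseChange ℂ x ∈ HU.piece p (n - p))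
    (ψ₁ : H₁.Polarization) (ψ₂ : H₂.Polarization) {Θ₁ : Module.End ℂ (ℂ ⊗[ℚ] V₁)}
    (hΘ₁ : ∀ p, ∀ x ∈ H₁.piece p (n - p), Θ₁ x = ((2 * p - n : ℤ) : ℂ) • x)
    {Θ₂ : Module.End ℂ (ℂ ⊗[ℚ] V₂)}
    (hΘ₂ : ∀ p, ∀ x ∈ H₂.piece p (n - p), Θ₂ x = ((2 * p - n : ℤ) : ℂ) • x)
    (hrigid : ∀ 𝔤₁ : Submodule ℚ (Module.End ℚ V₁), (∀ X ∈ 𝔤₁, ∀ X' ∈ 𝔤₁, X * X' - X' * X ∈ 𝔤₁) →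
      (∀ X ∈ 𝔤₁, ∀ v w, ψ₁.form (X v) w + ψ₁.form v (X w) = 0) → Θ₁ ∈ spanC 𝔤₁ →
      ∀ Y : Module.End ℂ (ℂ ⊗[ℚ] V₁),
        (∀ x y, ψ₁.form.baseChange ℂ (Y x) y + ψ₁.form.baseChange ℂ x (Y y) = 0) → Y ∈ spanC 𝔤₁)
    (hideal : ∀ I : Submodule ℂ (Module.End ℂ (ℂ ⊗[ℚ] V₁)),
      (∀ Y ∈ I, ∀ x y, ψ₁.form.baseChange ℂ (Y x) y + ψ₁.form.baseChange ℂ x (Y y) = 0) →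
      (∀ Zc : Module.End ℂ (ℂ ⊗[ℚ] V₁),
        (∀ x y, ψ₁.form.baseChange ℂ (Zc x) y + ψ₁.form.baseChange ℂ x (Zc y) = 0) →
          ∀ Y ∈ I, Zc * Y - Y * Zc ∈ I) → I ≠ ⊥ → Θ₁ ∈ I)
    (e h : Module.End ℚ V₁) (he0 : e ≠ 0) (heskew : ∀ v w, ψ₁.form (e v) w + ψ₁.form v (e w) = 0)
    (hhskew : ∀ v w, ψ₁.form (h v) w + ψ₁.form v (h w) = 0) (hhe : h * e - e * h = (2 : ℚ) • e)
    {r : ℕ} (Z : Fin r → Module.End ℂ (ℂ ⊗[ℚ] V₁)) (hZind : LinearIndependent ℂ Z)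
    (hZskew : ∀ i x y, ψ₁.form.baseChange ℂ (Z i x) y + ψ₁.form.baseChange ℂ x (Z i y) = 0)
    (haniso : ∀ X : Module.End ℚ V₂,
      (∀ a : H₂.endAlg, X * (a : Module.End ℚ V₂) = (a : Module.End ℚ V₂) * X) → X = 0 ∨ IsUnit X)
    (hdim : ∀ 𝔤₂ : Submodule ℚ (Module.End ℚ V₂),
      (∀ Y ∈ 𝔤₂, ∀ a : H₂.endAlg, Y * (a : Module.End ℚ V₂) = (a : Module.End ℚ V₂) * Y) →
      (∀ Y ∈ 𝔤₂, ∀ v w, ψ₂.form (Y v) w + ψ₂.form v (Y w) = 0) → Module.finrank ℚ 𝔤₂ ≤ r)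
    (eQ : Module.Basis (Fin M) ℚ U) (q : (Fin d → Fin m × Fin M) → ℚ)
    {ΘU : Module.End ℂ (ℂ ⊗[ℚ] U)} (hΘU : ∀ p, ∀ x ∈ HU.piece p (n - p), ΘU x = ((2 * p - n : ℤ) : ℂ) • x)
    (hΘq : ∀ u : Fin d → Fin m, wordDerAt ℂ (fun _ : Fin d =>
      LinearMap.toMatrix (Algebra.TensorProduct.basis ℂ eQ) (Algebra.TensorProduct.basis ℂ eQ) ΘU)
      (wordSlice (fun w => algebraMap ℚ ℂ (q w)) u) = 0)
    {W : Module.End ℂ (ℂ ⊗[ℚ] V₂)}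
    (hW : ∀ 𝔤₂ : Submodule ℚ (Module.End ℚ V₂), (∀ X ∈ 𝔤₂, ∀ X' ∈ 𝔤₂, X * X' - X' * X ∈ 𝔤₂) →
      Θ₂ ∈ spanC 𝔤₂ → (∀ X ∈ 𝔤₂, ∀ a : H₂.endAlg, X * (a : Module.End ℚ V₂) = (a : Module.End ℚ V₂) * X) →
      (∀ X ∈ 𝔤₂, ∀ v w, ψ₂.form (X v) w + ψ₂.form v (X w) = 0) → W ∈ spanC 𝔤₂)
    (u : Fin d → Fin m) :
    wordDerAt ℂ (fun _ : Fin d =>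
      LinearMap.toMatrix (Algebra.TensorProduct.basis ℂ eQ) (Algebra.TensorProduct.basis ℂ eQ)
        (ι₂.baseChange ℂ ∘ₗ W ∘ₗ π₂.baseChange ℂ))
      (wordSlice (fun w => algebraMap ℚ ℂ (q w)) u) = 0 := by
  classical
  set aF : H₂.endAlg ⊕ (Unit ⊕ Unit) → Module.End ℚ U :=
    Sum.elim (fun a : H₂.endAlg => ι₂ ∘ₗ (a : Module.End ℚ V₂) ∘ₗ π₂)
      (Sum.elim (fun _ : Unit => ι₁ ∘ₗ π₁) (fun _ : Unit => ι₂ ∘ₗ π₂)) with haF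
  set φ : LinearMap.BilinForm ℚ U := ψ₁.form.compl₁₂ π₁ π₁ + ψ₂.form.compl₁₂ π₂ π₂ with hφ
  set 𝔞 : Submodule ℚ (Module.End ℚ U) := annLie φ eQ aF q with h𝔞
  obtain ⟨-, h2, hΘ𝔞⟩ := incl_skew_mem_annLie_of_symplectic_times_anisotropic HU H₁ H₂ hπι₁ hπι₂ hπ₁ι₂ hπ₂ι₁
    hsum hι₁F hι₂F ψ₁ ψ₂ hΘ₁ hΘ₂ hrigid hideal e h he0 heskew hhskew hhe Z hZind hZskew haniso hdim eQ q hΘU hΘq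
  have hsum' : ι₂ ∘ₗ π₂ + ι₁ ∘ₗ π₁ = LinearMap.id := by rw [add_comm]; exact hsum
  have e22 : ∀ w, π₂ (ι₂ w) = w := fun w => by
    rw [← LinearMap.comp_apply (f := π₂), hπι₂, LinearMap.id_apply]
  have e12 : ∀ w, π₁ (ι₂ w) = 0 := fun w => by
    rw [← LinearMap.comp_apply (f := π₁), hπ₁ι₂, LinearMap.zero_apply]
  have hΘι₂ := theta_incl_eq HU H₂ hι₂F hΘU hΘ₂
  have hmem : ∀ X ∈ 𝔞, (∀ i, X * aF i = aF i * X) ∧ ∀ v w, φ (X v) w + φ v (X w) = 0 :=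
    fun X hX => ((mem_annLie_iff φ eQ aF q X).1 hX).2
  have hbr𝔞 : ∀ X ∈ 𝔞, ∀ X' ∈ 𝔞, X * X' - X' * X ∈ 𝔞 := fun X hX X' hX' =>
    commutator_mem_annLie φ eQ aF q hX hX'
  have hP₁ : ∀ X ∈ 𝔞, X * (ι₁ ∘ₗ π₁) = (ι₁ ∘ₗ π₁) * X := fun X hX => (hmem X hX).1 (Sum.inr (Sum.inl ()))
  have hP₂ : ∀ X ∈ 𝔞, X * (ι₂ ∘ₗ π₂) = (ι₂ ∘ₗ π₂) * X := fun X hX => (hmem X hX).1 (Sum.inr (Sum.inr ()))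
  have hTa : ∀ X ∈ 𝔞, ∀ a : H₂.endAlg, X * (ι₂ ∘ₗ (a : Module.End ℚ V₂) ∘ₗ π₂) =
      (ι₂ ∘ₗ (a : Module.End ℚ V₂) ∘ₗ π₂) * X := fun X hX a => (hmem X hX).1 (Sum.inl a)
  have hφapply : ∀ x y, φ x y = ψ₁.form (π₁ x) (π₁ y) + ψ₂.form (π₂ x) (π₂ y) := fun x y => by
    rw [hφ, LinearMap.add_apply, LinearMap.add_apply, LinearMap.compl₁₂_apply, LinearMap.compl₁₂_apply]
  -- the second corner algebra `𝔤₂ = c₂(𝔞)` is admissible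
  obtain ⟨cL₂, hcL₂⟩ : ∃ L : Module.End ℚ U →ₗ[ℚ] Module.End ℚ V₂, ∀ X, L X = π₂ ∘ₗ X ∘ₗ ι₂ :=
    ⟨{ toFun := fun X => π₂ ∘ₗ X ∘ₗ ι₂
       map_add' := fun X X' => by rw [LinearMap.add_comp, LinearMap.comp_add]
       map_smul' := fun c X => by rw [LinearMap.smul_comp, LinearMap.comp_smul, RingHom.id_apply] },
      fun X => rfl⟩
  set 𝔤₂ : Submodule ℚ (Module.End ℚ V₂) := 𝔞.map cL₂ with h𝔤₂
  have h𝔤₂mem : ∀ {Y'}, Y' ∈ 𝔤₂ ↔ ∃ X ∈ 𝔞, π₂ ∘ₗ X ∘ₗ ι₂ = Y' := by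
    intro Y'
    rw [h𝔤₂, Submodule.mem_map]
    simp only [hcL₂]
  have hbr𝔤₂ : ∀ Y' ∈ 𝔤₂, ∀ Y'' ∈ 𝔤₂, Y' * Y'' - Y'' * Y' ∈ 𝔤₂ := by
    intro Y' hY' Y'' hY''
    obtain ⟨X, hX, rfl⟩ := h𝔤₂mem.1 hY'
    obtain ⟨X', hX', rfl⟩ := h𝔤₂mem.1 hY''
    exact h𝔤₂mem.2 ⟨_, hbr𝔞 X hX X' hX',
      corner_bracket hπι₂ hπι₁ hπ₂ι₁ hsum' (hP₂ X hX) (hP₁ X hX) (hP₂ X' hX') (hP₁ X' hX')⟩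
  have hcomm𝔤₂ : ∀ Y' ∈ 𝔤₂, ∀ a : H₂.endAlg, Y' * (a : Module.End ℚ V₂) = (a : Module.End ℚ V₂) * Y' := by
    intro Y' hY' a
    obtain ⟨X, hX, rfl⟩ := h𝔤₂mem.1 hY'
    apply LinearMap.ext
    intro v
    have h := congrArg (fun f : Module.End ℚ U => π₂ (f (ι₂ v))) (hTa X hX a)
    simp only [Module.End.mul_apply, LinearMap.comp_apply, e22] at h
    simp only [Module.End.mul_apply, LinearMap.comp_apply]
    exact h
  have hskew𝔤₂ : ∀ Y' ∈ 𝔤₂, ∀ v w, ψ₂.form (Y' v) w + ψ₂.form v (Y' w) = 0 := by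
    intro Y' hY' v w
    obtain ⟨X, hX, rfl⟩ := h𝔤₂mem.1 hY'
    have h := (hmem X hX).2 (ι₂ v) (ι₂ w)
    rw [apply_incl_eq_of_commute_projector hπι₂ (hP₂ X hX) v,
      apply_incl_eq_of_commute_projector hπι₂ (hP₂ X hX) w, hφapply, hφapply] at h
    simp only [e22, e12, map_zero, zero_add] at h
    simpa only [LinearMap.comp_apply] using h
  have hcorner₂ : ∀ T ∈ spanC 𝔞, π₂.baseChange ℂ ∘ₗ T ∘ₗ ι₂.baseChange ℂ ∈ spanC 𝔤₂ := by
    intro T hT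
    induction hT using Submodule.span_induction with
    | mem Z' hZ' =>
      obtain ⟨X, hX, rfl⟩ := hZ'
      rw [← LinearMap.baseChange_comp, ← LinearMap.baseChange_comp]
      exact baseChange_mem_spanC (h𝔤₂mem.2 ⟨X, hX, rfl⟩)
    | zero => rw [LinearMap.zero_comp, LinearMap.comp_zero]; exact Submodule.zero_mem _
    | add Z' Z'' _ _ hZ' hZ'' => rw [LinearMap.add_comp, LinearMap.comp_add]; exact Submodule.add_mem _ hZ' hZ''
    | smul c Z' _ hZ' => rw [LinearMap.smul_comp, LinearMap.comp_smul]; exact Submodule.smul_mem _ c hZ'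
  have hΘ𝔤₂ : Θ₂ ∈ spanC 𝔤₂ := by
    have h : Θ₂ = π₂.baseChange ℂ ∘ₗ ΘU ∘ₗ ι₂.baseChange ℂ := by
      apply LinearMap.ext
      intro x
      rw [LinearMap.comp_apply, LinearMap.comp_apply, hΘι₂, proj_incl_baseChange hπι₂]
    rw [h]
    exact hcorner₂ ΘU hΘ𝔞
  have hW𝔤₂ : W ∈ spanC 𝔤₂ := hW 𝔤₂ hbr𝔤₂ hΘ𝔤₂ hcomm𝔤₂ hskew𝔤₂
  -- elements of `(𝔤₂)_ℂ`, placed on `V₂`, lie in `𝔞_ℂ`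
  have hplace : ∀ W' ∈ spanC 𝔤₂, ι₂.baseChange ℂ ∘ₗ W' ∘ₗ π₂.baseChange ℂ ∈ spanC 𝔞 := by
    intro W' hW'
    induction hW' using Submodule.span_induction with
    | mem W₁ hW₁ =>
      obtain ⟨Y₂, hY₂, rfl⟩ := hW₁
      obtain ⟨X, hX, rfl⟩ := h𝔤₂mem.1 hY₂
      rw [← LinearMap.baseChange_comp, ← LinearMap.baseChange_comp]
      exact baseChange_mem_spanC (h2 X hX)
    | zero => rw [LinearMap.zero_comp, LinearMap.comp_zero]; exact Submodule.zero_mem _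
    | add W₁ W₂ _ _ hW₁ hW₂ => rw [LinearMap.add_comp, LinearMap.comp_add]; exact Submodule.add_mem _ hW₁ hW₂
    | smul c W₁ _ hW₁ => rw [LinearMap.smul_comp, LinearMap.comp_smul]; exact Submodule.smul_mem _ c hW₁
  exact wordDerAt_eq_zero_of_mem_spanC_annLie φ eQ aF q (hplace _ hW𝔤₂) u

end Main

end HodgeStructure

end Literature.AlgebraicGeometry.Motives

end
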